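import Summits.AtomisticToContinuum.Crystallization.Theses.FrustrationRangeCertificates
import Summits.AtomisticToContinuum.Crystallization.Theorems.FrustrationRangeCertificatesPatternPricedCertificatesStubLensLift
import Summits.AtomisticToContinuum.Crystallization.Theorems.FrustrationRangeCertificatesPatternPricedCertificatesStubFarField
import Summits.AtomisticToContinuum.Crystallization.Theorems.FrustrationRangeCertificatesPatternPricedCertificatesStubAbstractMeanDuality
import Summits.AtomisticToContinuum.Crystallization.Theorems.FrustrationRangeCertificatesPatternPricedCertificatesStubBanachLimit
import Summits.AtomisticToContinuum.Crystallization.Theorems.FrustrationRangeCertificatesPatternPricedCertificatesStubPatternFarField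
import Summits.AtomisticToContinuum.Crystallization.Theorems.FrustrationRangeCertificatesPatternPricedCertificatesStubLevelRestrict
import Summits.AtomisticToContinuum.Crystallization.Theorems.FrustrationRangeCertificatesPatternPricedCertificatesStubMeanDuality
import Summits.AtomisticToContinuum.Crystallization.Theorems.FrustrationRangeCertificatesPatternPricedCertificatesStubLevelLift
import Summits.AtomisticToContinuum.Crystallization.Theorems.FrustrationRangeCertificatesPatternPricedCertificatesStubPeriodicMeanFamily
import Summits.AtomisticToContinuum.Crystallization.Theorems.FrustrationRangeCertificatesPatternPricedCertificatesStubPeriodicTransport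
import Summits.AtomisticToContinuum.Crystallization.Theorems.FrustrationRangeCertificatesPatternPricedCertificatesStubPeriodicTruncatedEnergy
import Summits.AtomisticToContinuum.Crystallization.Theorems.FrustrationRangeCertificatesPatternPricedCertificatesStubUnpricedMeanBound
import Summits.AtomisticToContinuum.Crystallization.Theorems.FrustrationRangeCertificatesPatternPricedCertificatesStubMeanToLaw
import Summits.AtomisticToContinuum.Crystallization.Theorems.FrustrationRangeCertificatesPatternPricedCertificatesStubCampbellToStationary
import Summits.AtomisticToContinuum.Crystallization.Theorems.FrustrationRangeCertificatesPatternPricedCertificatesStubLawEnergy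
import Summits.AtomisticToContinuum.Crystallization.Theorems.FrustrationRangeCertificatesPatternPricedCertificatesStubLawBack
import Summits.AtomisticToContinuum.Crystallization.Theorems.FrustrationRangeCertificatesPatternPricedCertificatesStubMeanCampbell
import Summits.AtomisticToContinuum.Crystallization.Theorems.FrustrationRangeCertificatesPatternPricedCertificatesSplit
import Literature.MathematicalPhysics.StatisticalMechanics.TransferLevelValue
import Literature.MathematicalPhysics.StatisticalMechanics.BarlowStacking
import Literature.Probability.Process.RootedHardCoreVague
import Literature.Probability.Process.PointStationaryLaw
import Summits.AtomisticToContinuum.Crystallization.Theses.PalmUnimodularRigidity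
import Summits.AtomisticToContinuum.Crystallization.Theorems.PalmUnimodularRigidityBenjaminiSchrammLimitEmbedding
import Literature.Probability.PointProcesses.LensConsistentLaw
import Summits.AtomisticToContinuum.Crystallization.Theorems.ChargedEnergyGap.Negative.BlocksBound
import Summits.AtomisticToContinuum.Crystallization.Theorems.ChargedEnergyGap.Negative.Periodisation

/-!
# Crux `PatternPricedCertificates` (stmt-AtomisticToContinuum-12974) — line `registered`, skeleton v13 (cycle c3: B5' `stub_hcpUniqueMinimiser` LANDED by name p171947; the ONLY stub left is the external `stub_palmRigidity` = stmt-9224)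

v13 (lead c3, 2026-08-17): the box-local hcp unique-minimiser B5' is no longer a numerics residue — it is the landed theorem
`Summit.AtomisticToContinuum.Crystallization.Theorems.PatternPricedCertificates.stub_hcpUniqueMinimiser`
(`Theorems/FrustrationRangeCertificatesPatternPricedCertificatesSplit.lean`, p171947), a bookkeeping consequence of the certified
lattice-sum development of crux `LayeredLawsSelectHcp` (route PalmUnimodularRigidity): `stub_relaxedReference` (a global minimiser
of the total hcp energy `hcpE` exists in `[189/200,199/200] × [77/100,163/200] ⊂ [1/2,2]²`), `tube_hcpE_unique_minimiser` (the global
minimiser of `hcpE` over the open quadrant is unique) and `energyPerParticle_hcp_eq_hcpE` (`e(hcp_{a,h}) = hcpE a h`). Below, the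
stub `stub_hcpUniqueMinimiser` is discharged `exact` by that name; the skeleton is closed modulo `stub_palmRigidity` alone, and the
same file gives the tree theorem `patternPricedCertificates_of_palmRigidity_alone : PalmRigidity → PatternPricedCertificates`
(and the strategist's split glue `PatternPricedCertificates_of_subs : MinimiserShells → LayeredLawsSelectHcp → PatternPricedCertificates`
through the CLOSED items `ShellsToBarlowChart` stmt-9227 and `CruxesToPalmRigidity` stmt-9228). The crux is `blocked-on: stmt-9224`.

Route `FrustrationRangeCertificates` (route-AtomisticToContinuum-FrustrationRangeCertificates), crux rank 2
(thesis X): one periodic `P` such that for all pattern tests `(R, ε)` and budgets `θ > 0` there are a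
separation `δ` obeyed by all Lennard-Jones ground states, a level `L`, constants `c`, `κ ∈ (0, 1]`, a
pattern-local transfer rule `Φ (v, pat_L i, pat_L j)` and a periodic `Q` with `e(Q) ≤ c + κθ` such that on
EVERY finite `δ`-separated configuration, at every particle,
`c + κ·1[(R, ε)-pattern of i is not an isometric copy of P's] ≤ ½ Σ_{j ≠ i} V_LJ(|x_i − x_j|) + Σ_{j ≠ i} [Φ(i→j) − Φ(j→i)]`.

## The line (unchanged): the finite-level dual LP lives on ROOTED PATTERNS — near field by mass transport, far field by summability

The birth skeleton cut the crux into the dual LP object at finite level (`Sig.stub_patternCertificates`: a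
pattern-pointwise priced certificate for the `L`-truncated one-centre energy with a bounded-range
pattern-local transfer rule — an m-potential / admissible score function, Holsztyński–Sławny 1978 §3,
Lagarias 2002 Def. 2.4), the lens lift (`stub_lensLift`, LANDED p146722) and the far field (`stub_farField`,
LANDED p149284); the assembly `PatternPricedCertificates_of_dual : Sig.stub_patternCertificates → crux` below is
the registered birth assembly verbatim.

## This reshape (lead c1): the dual stub is DERIVED from its primal twin by transfer duality and a level lift

The dual object is the LP's output; the statement one can hope to attack (and the one refuters attack with
pseudo-laws) is the PRIMAL: priced rigidity of point-stationary laws of rooted hard-core configurations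
(the route's foreseen split PrimalRigidity → TransferDuality → LevelLift; kill criterion (iv)). Phrased with
FINITELY ADDITIVE laws (means = positive normalised linear functionals on bounded pattern functionals), both
connecting pieces are theorems of soft analysis and are proved in this line:

* `stub_stationaryMeansRigidity` — **THE OPEN CORE (primal, level ∞).** One periodic `P`; for all
  `δ, R, ε, θ > 0` a price `κ ∈ (0, 1]`, a constant `c` and a periodic `Q` with `e(Q) ≤ c + κθ` such that for
  every POINT-STATIONARY MEAN FAMILY `ℓ` on rooted `δ`-separated configurations of `ℝ³` (a projective family
  `ρ ↦ ℓ ρ` of means on `(δ, ρ)`-admissible rooted patterns, consistent under every finite-level mass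
  transport `T^{(r,ρ)}_g`, `g` bounded) and every radius `ρ ≥ max (R + ε) 1`:
  `c + κ · ℓ(bad_{P,R,ε}) ≤ ℓ ρ (½ h_ρ)`, i.e. (the right side decreases to the energy per particle)
  **every stationary hard-core law with energy per particle `≤ e(Q) − κθ + κ b` has defect mass `≤ b`** —
  the quantitative ("priced") Palm rigidity, finitely additive twin of stmt-9224 `PalmRigidity`.
* `stub_levelLift` — **LEVEL LIFT (provable; layer 2 of this skeleton).** The level-∞ primal inequality
  implies, for every `η > 0`, the finite-level primal inequality `c − η + κ m(bad) ≤ m(½ h_L)` for all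
  lens-consistent MEANS `m` at some level `(r, L)` beyond any prescribed `L₀`: if it failed along
  `L_n → ∞` (`r_n = n`), a Banach limit (`stub_banachLimit`) of the violating means `m_n ∘ (· ∘ B_ρ)` is a
  point-stationary mean family (`stub_levelRestrict` turns every lower-level transport into a level-`(r_n,
  L_n)` transport; the defect indicator is a cylinder functional of radius `R + ε`; the energy passes to the
  limit by the pattern-level far-field bound `stub_patternFarField`), violating the hypothesis.
* `stub_meanDuality` — **STRONG DUALITY AT FINITE LEVEL FOR MEANS (provable; layer 2).** If every
  lens-consistent mean `m` at level `(δ, r, L)` has `m a ≥ 0` (`a` bounded on admissible patterns) then for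
  every `η > 0` a BOUNDED rule `g` achieves `a + T_g ≥ −η` pointwise: the algebraic Hahn–Banach theorem
  (`exists_extension_of_le_sublinear`) applied to the sublinear functional `N h = inf_g sup_Ω (h + T_g)` —
  `stub_abstractMeanDuality`, LP duality for means over an arbitrary index set, no topology.
* Infrastructure stubs for workers: `stub_abstractMeanDuality`, `stub_banachLimit`, `stub_patternFarField`,
  `stub_levelRestrict` (all folklore / textbook, independent of the crux).

Composition (sorry-free given the stubs): `dualCertificates_of : Sig.stub_stationaryMeansRigidity →
Sig.stub_levelLift → Sig.stub_meanDuality → Sig.stub_patternCertificates` (budget split: primal at `θ/2`,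
level lift with `η = κθ/4`, duality with `η = κθ/4`, `a := ½ h_L − κ·bad − (c − κθ/4)` bounded by the
packing bound `levelLift_abs_sum_le`), then the birth assembly. The registered skeleton theorem concluding
the crux BY NAME is `PatternPricedCertificates_of : Sig.stub_stationaryMeansRigidity → PatternPricedCertificates`
(it invokes the stubs `stub_levelLift`, `stub_meanDuality`), closed instance `PatternPricedCertificates_skeleton`.

Disproof used: none filed for this crux (`ledger crux ls stmt-AtomisticToContinuum-12974`, 2026-08-17: no
`Disproof.lean`). Refuter notes honoured as in the birth card (hidden requirement `0 ∈ P.points` /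
vertex-transitivity of `P` inherited through `insert 0 S`; `κ = O(1/R)`; level freedom `∀ L₀ ∃ L ≥ L₀`).
Sanity of the core against cheap mean families: the vacuum family `ℓ ρ f = f ∅` forces only `c + κ ≤ 0`
(bad) / `c ≤ 0`; rooted lattices force `κ ≤ e(lattice) − c`; in general `κ ≤` the stationary defect price.
-/

noncomputable section

namespace Summit.AtomisticToContinuum.Crystallization.Cruxes.PatternPricedCertificates.Birth

open scoped BigOperators Topology Manifold Classical MeasureTheory ProbabilityTheory Matrix InnerProductSpace ComplexConjugate ContinuousMap

/-! ## The registered stubs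

Conventions inlined in every signature (tree vocabulary only):
* transfer functional at level `(r, L)` of a rule `g`:
  `T g S = Σ_{v ∈ lens r L S} [g v (B_r S) (B_r (reroot S v)) − g (−v) (B_r (reroot S v)) (B_r S)]`;
* defect indicator `bad S = if (insert 0 S is (R, ε)-matched both ways to an isometric copy of P.points) then 0 else 1`;
* half energy `½ h S = (Σ_{v ∈ S} V_LJ ‖v‖) / 2`;
* a MEAN at level `(δ, L)` is `m : (Finset E → ℝ) → ℝ`, additive, homogeneous, `≥ 0` on functionals valued in
  `[0, 1]` on `(δ, L)`-admissible patterns, `m 1 = 1`; LENS-CONSISTENT at `(r, L)` if `m (T g) = 0` for every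
  bounded `g`; a POINT-STATIONARY MEAN FAMILY is `ℓ : ℝ → (Finset E → ℝ) → ℝ` with every `ℓ ρ` a mean at
  `(δ, ρ)`, projective (`ℓ ρ' (f ∘ B_ρ) = ℓ ρ f` for `ρ ≤ ρ'`) and lens-consistent at every level `(r, ρ)`, `0 ≤ r`.
-/

/-- **Stub B (level lift; provable, layer 2).** For fixed `P, δ, R, ε, κ, c` the level-∞ primal inequality over point-stationary mean families implies, for every `η > 0` and `L₀`, the finite-level primal inequality `c − η + κ m(bad) ≤ m(½ h_L)` for all lens-consistent means `m` at some level `(r, L)` with `L₀ ≤ L`, `R + ε ≤ L`, `0 ≤ r ≤ L` (Banach limit of violating means along `L_n → ∞`, `r_n = n`; `stub_banachLimit`, `stub_levelRestrict`, `stub_patternFarField`). [folklore] -/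
theorem stub_levelLift :
    ∀ (P : Literature.MathematicalPhysics.StatisticalMechanics.PeriodicConfiguration 3) (δ R ε κ c : ℝ), 0 < δ → 0 < R → 0 < ε →
      (∀ ℓ : ℝ → (Finset (EuclideanSpace ℝ (Fin 3)) → ℝ) → ℝ,
        (∀ (ρ : ℝ) (f₁ f₂ : Finset (EuclideanSpace ℝ (Fin 3)) → ℝ), ℓ ρ (f₁ + f₂) = ℓ ρ f₁ + ℓ ρ f₂) →
        (∀ (ρ t : ℝ) (f : Finset (EuclideanSpace ℝ (Fin 3)) → ℝ), ℓ ρ (t • f) = t * ℓ ρ f) →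
        (∀ (ρ : ℝ) (f : Finset (EuclideanSpace ℝ (Fin 3)) → ℝ), (∀ S : Finset (EuclideanSpace ℝ (Fin 3)), Literature.Probability.PointProcesses.IsRootedPattern δ ρ S → 0 ≤ f S ∧ f S ≤ 1) → 0 ≤ ℓ ρ f) →
        (∀ ρ : ℝ, ℓ ρ (fun _ => 1) = 1) →
        (∀ ρ ρ' : ℝ, ρ ≤ ρ' → ∀ f : Finset (EuclideanSpace ℝ (Fin 3)) → ℝ, ℓ ρ' (fun S => f (Literature.Probability.PointProcesses.ballPattern ρ S)) = ℓ ρ f) →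
        (∀ r ρ : ℝ, 0 ≤ r → ∀ g : EuclideanSpace ℝ (Fin 3) → Finset (EuclideanSpace ℝ (Fin 3)) → Finset (EuclideanSpace ℝ (Fin 3)) → ℝ, (∃ M : ℝ, ∀ v p q, |g v p q| ≤ M) →
          ℓ ρ (fun S => ∑ v ∈ Literature.Probability.PointProcesses.lens r ρ S, (g v (Literature.Probability.PointProcesses.ballPattern r S) (Literature.Probability.PointProcesses.ballPattern r (Literature.Probability.PointProcesses.reroot S v)) - g (-v) (Literature.Probability.PointProcesses.ballPattern r (Literature.Probability.PointProcesses.reroot S v)) (Literature.Probability.PointProcesses.ballPattern r S))) = 0) →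
        ∀ ρ : ℝ, R + ε ≤ ρ → 1 ≤ ρ →
          c + κ * ℓ ρ (fun S => (if (∃ A : EuclideanSpace ℝ (Fin 3) →ₗᵢ[ℝ] EuclideanSpace ℝ (Fin 3), (∀ p ∈ P.points, ‖p‖ ≤ R → ∃ v ∈ insert (0 : EuclideanSpace ℝ (Fin 3)) S, dist v (A p) ≤ ε) ∧ (∀ v ∈ insert (0 : EuclideanSpace ℝ (Fin 3)) S, ‖v‖ ≤ R → ∃ p ∈ P.points, dist v (A p) ≤ ε)) then (0 : ℝ) else 1)) ≤
            ℓ ρ (fun S => (∑ v ∈ S, Literature.MathematicalPhysics.StatisticalMechanics.lennardJones ‖v‖) / 2)) →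
      ∀ η : ℝ, 0 < η → ∀ L₀ : ℝ, ∃ L r : ℝ, L₀ ≤ L ∧ R + ε ≤ L ∧ 0 ≤ r ∧ r ≤ L ∧
        ∀ m : (Finset (EuclideanSpace ℝ (Fin 3)) → ℝ) → ℝ,
          (∀ f₁ f₂ : Finset (EuclideanSpace ℝ (Fin 3)) → ℝ, m (f₁ + f₂) = m f₁ + m f₂) →
          (∀ (t : ℝ) (f : Finset (EuclideanSpace ℝ (Fin 3)) → ℝ), m (t • f) = t * m f) →
          (∀ f : Finset (EuclideanSpace ℝ (Fin 3)) → ℝ, (∀ S : Finset (EuclideanSpace ℝ (Fin 3)), Literature.Probability.PointProcesses.IsRootedPattern δ L S → 0 ≤ f S ∧ f S ≤ 1) → 0 ≤ m f) →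
          m (fun _ => 1) = 1 →
          (∀ g : EuclideanSpace ℝ (Fin 3) → Finset (EuclideanSpace ℝ (Fin 3)) → Finset (EuclideanSpace ℝ (Fin 3)) → ℝ, (∃ M : ℝ, ∀ v p q, |g v p q| ≤ M) →
            m (fun S => ∑ v ∈ Literature.Probability.PointProcesses.lens r L S, (g v (Literature.Probability.PointProcesses.ballPattern r S) (Literature.Probability.PointProcesses.ballPattern r (Literature.Probability.PointProcesses.reroot S v)) - g (-v) (Literature.Probability.PointProcesses.ballPattern r (Literature.Probability.PointProcesses.reroot S v)) (Literature.Probability.PointProcesses.ballPattern r S))) = 0) →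
          c - η + κ * m (fun S => (if (∃ A : EuclideanSpace ℝ (Fin 3) →ₗᵢ[ℝ] EuclideanSpace ℝ (Fin 3), (∀ p ∈ P.points, ‖p‖ ≤ R → ∃ v ∈ insert (0 : EuclideanSpace ℝ (Fin 3)) S, dist v (A p) ≤ ε) ∧ (∀ v ∈ insert (0 : EuclideanSpace ℝ (Fin 3)) S, ‖v‖ ≤ R → ∃ p ∈ P.points, dist v (A p) ≤ ε)) then (0 : ℝ) else 1)) ≤
            m (fun S => (∑ v ∈ S, Literature.MathematicalPhysics.StatisticalMechanics.lennardJones ‖v‖) / 2) := by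
  exact Summit.AtomisticToContinuum.Crystallization.Theorems.PatternPricedCertificates.stub_levelLift

/-- **Stub C (strong duality at finite level for means; provable, layer 2).** If every lens-consistent mean at level `(δ, r, L)` is non-negative on a functional `a` bounded on admissible patterns, then for every `η > 0` some BOUNDED rule `g` has `a + T_g ≥ −η` on all admissible patterns (`stub_abstractMeanDuality` with `Ω` the admissible patterns and `K = {T_g : g bounded}`; the vacuum pattern `∅` has `T_g ∅ = 0`). [folklore] -/
theorem stub_meanDuality :
    ∀ (δ r L : ℝ), 0 < δ → ∀ a : Finset (EuclideanSpace ℝ (Fin 3)) → ℝ, (∃ M : ℝ, ∀ S : Finset (EuclideanSpace ℝ (Fin 3)), Literature.Probability.PointProcesses.IsRootedPattern δ L S → |a S| ≤ M) →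
      (∀ m : (Finset (EuclideanSpace ℝ (Fin 3)) → ℝ) → ℝ,
        (∀ f₁ f₂ : Finset (EuclideanSpace ℝ (Fin 3)) → ℝ, m (f₁ + f₂) = m f₁ + m f₂) →
        (∀ (t : ℝ) (f : Finset (EuclideanSpace ℝ (Fin 3)) → ℝ), m (t • f) = t * m f) →
        (∀ f : Finset (EuclideanSpace ℝ (Fin 3)) → ℝ, (∀ S : Finset (EuclideanSpace ℝ (Fin 3)), Literature.Probability.PointProcesses.IsRootedPattern δ L S → 0 ≤ f S ∧ f S ≤ 1) → 0 ≤ m f) →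
        m (fun _ => 1) = 1 →
        (∀ g : EuclideanSpace ℝ (Fin 3) → Finset (EuclideanSpace ℝ (Fin 3)) → Finset (EuclideanSpace ℝ (Fin 3)) → ℝ, (∃ M : ℝ, ∀ v p q, |g v p q| ≤ M) →
          m (fun S => ∑ v ∈ Literature.Probability.PointProcesses.lens r L S, (g v (Literature.Probability.PointProcesses.ballPattern r S) (Literature.Probability.PointProcesses.ballPattern r (Literature.Probability.PointProcesses.reroot S v)) - g (-v) (Literature.Probability.PointProcesses.ballPattern r (Literature.Probability.PointProcesses.reroot S v)) (Literature.Probability.PointProcesses.ballPattern r S))) = 0) →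
        0 ≤ m a) →
      ∀ η : ℝ, 0 < η → ∃ g : EuclideanSpace ℝ (Fin 3) → Finset (EuclideanSpace ℝ (Fin 3)) → Finset (EuclideanSpace ℝ (Fin 3)) → ℝ, (∃ M : ℝ, ∀ v p q, |g v p q| ≤ M) ∧
        ∀ S : Finset (EuclideanSpace ℝ (Fin 3)), Literature.Probability.PointProcesses.IsRootedPattern δ L S →
          -η ≤ a S + ∑ v ∈ Literature.Probability.PointProcesses.lens r L S, (g v (Literature.Probability.PointProcesses.ballPattern r S) (Literature.Probability.PointProcesses.ballPattern r (Literature.Probability.PointProcesses.reroot S v)) - g (-v) (Literature.Probability.PointProcesses.ballPattern r (Literature.Probability.PointProcesses.reroot S v)) (Literature.Probability.PointProcesses.ballPattern r S)) := by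
  exact Summit.AtomisticToContinuum.Crystallization.Theorems.PatternPricedCertificates.stub_meanDuality

/-- **Stub (1) (abstract LP duality for means; Hahn–Banach).** For an index set `Ω ⊆ α`, a set `K` of functions closed under `+` and real scaling, containing `0`, with `a` and every `k ∈ K` bounded on `Ω` and no `k ∈ K` uniformly negative on `Ω`, there is a mean on `Ω` (additive, homogeneous, `≥ 0` on `[0,1]`-valued-on-`Ω` functions, `m 1 = 1`) vanishing on `K` with `m a ≤ sup_{k ∈ K} inf_Ω (a + k)` (stated pointwise). Proof: the sublinear functional `N h = inf {s | ∃ k ∈ K, h + k ≤ s on Ω}` on the space of `Ω`-bounded functions, `exists_extension_of_le_sublinear` from the span of `a` with value `−N(−a)`, then `LinearMap.exists_extend` to all functions. [cite: Rudin, Functional Analysis (1991), Thm 3.2] [folklore]  -/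
theorem stub_abstractMeanDuality :
    ∀ (α : Type) (Ω : Set α) (K : Set (α → ℝ)) (a : α → ℝ),
      (∀ k₁ ∈ K, ∀ k₂ ∈ K, k₁ + k₂ ∈ K) → (∀ (t : ℝ), ∀ k ∈ K, t • k ∈ K) → (0 : α → ℝ) ∈ K →
      (∃ M : ℝ, ∀ x ∈ Ω, |a x| ≤ M) → (∀ k ∈ K, ∃ M : ℝ, ∀ x ∈ Ω, |k x| ≤ M) →
      (∀ k ∈ K, ∀ t : ℝ, t < 0 → ∃ x ∈ Ω, t < k x) →
      ∃ m : (α → ℝ) → ℝ,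
        (∀ f₁ f₂ : α → ℝ, m (f₁ + f₂) = m f₁ + m f₂) ∧ (∀ (t : ℝ) (f : α → ℝ), m (t • f) = t * m f) ∧
        (∀ f : α → ℝ, (∀ x ∈ Ω, 0 ≤ f x ∧ f x ≤ 1) → 0 ≤ m f) ∧ m (fun _ => 1) = 1 ∧
        (∀ k ∈ K, m k = 0) ∧
        ∀ t : ℝ, (∀ k ∈ K, ∃ x ∈ Ω, a x + k x < t) → m a ≤ t := by
  exact Summit.AtomisticToContinuum.Crystallization.Theorems.PatternPricedCertificates.stub_abstractMeanDuality

/-- **Stub (2) (a Banach-type limit).** A positive normalised linear functional on real sequences (positivity for `[0,1]`-valued sequences) vanishing on eventually-zero sequences (limit along a free ultrafilter, `Filter.hyperfilter ℕ`, extended linearly). [folklore] -/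
theorem stub_banachLimit :
    ∃ Λ : (ℕ → ℝ) → ℝ,
      (∀ a b : ℕ → ℝ, Λ (a + b) = Λ a + Λ b) ∧ (∀ (t : ℝ) (a : ℕ → ℝ), Λ (t • a) = t * Λ a) ∧
      (∀ a : ℕ → ℝ, (∀ n, 0 ≤ a n ∧ a n ≤ 1) → 0 ≤ Λ a) ∧ Λ (fun _ => 1) = 1 ∧
      ∀ a : ℕ → ℝ, (∃ n₀ : ℕ, ∀ n, n₀ ≤ n → a n = 0) → Λ a = 0 := by
  exact Summit.AtomisticToContinuum.Crystallization.Theorems.PatternPricedCertificates.stub_banachLimit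

/-- **Stub (3a) (far field at pattern level).** For `δ > 0` and `η > 0` there is `ρ₀` such that for every `(δ, L)`-admissible rooted pattern `S` the Lennard-Jones energy of the root with the points of `S` beyond distance `ρ ≥ ρ₀` is `≥ −η` (embed `insert 0 S` as a finite `δ`-separated configuration and apply the landed `stub_farField`, or sum dyadic shells directly). [folklore] -/
theorem stub_patternFarField :
    ∀ δ : ℝ, 0 < δ → ∀ η : ℝ, 0 < η → ∃ ρ₀ : ℝ, ∀ ρ L : ℝ, ρ₀ ≤ ρ →
      ∀ S : Finset (EuclideanSpace ℝ (Fin 3)), Literature.Probability.PointProcesses.IsRootedPattern δ L S →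
        -η ≤ ∑ v ∈ S.filter (fun v => ¬ ‖v‖ ≤ ρ), Literature.MathematicalPhysics.StatisticalMechanics.lennardJones ‖v‖ := by
  exact Summit.AtomisticToContinuum.Crystallization.Theorems.PatternPricedCertificates.stub_patternFarField

/-- **Stub (3c) (restriction of transports between levels).** For `0 ≤ r ≤ r'` and `ρ − r ≤ L − r'`, the level-`(r, ρ)` transport of a rule `g` evaluated on the `ρ`-ball of a pattern is the level-`(r', L)` transport, on the pattern itself, of the rule `ĝ v p q = 1[‖v‖ ≤ ρ − r] · g v (B_r p) (B_r q)` (`B_r ∘ B_{r'} = B_r`, `B_r (reroot (B_ρ S) v) = B_r (reroot S v)` for `‖v‖ ≤ ρ − r`, and the lens ranges agree). [folklore] -/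
theorem stub_levelRestrict :
    ∀ (r r' ρ L : ℝ), 0 ≤ r → r ≤ r' → ρ - r ≤ L - r' →
      ∀ (g : EuclideanSpace ℝ (Fin 3) → Finset (EuclideanSpace ℝ (Fin 3)) → Finset (EuclideanSpace ℝ (Fin 3)) → ℝ) (S : Finset (EuclideanSpace ℝ (Fin 3))),
        (∑ v ∈ Literature.Probability.PointProcesses.lens r ρ (Literature.Probability.PointProcesses.ballPattern ρ S), (g v (Literature.Probability.PointProcesses.ballPattern r (Literature.Probability.PointProcesses.ballPattern ρ S)) (Literature.Probability.PointProcesses.ballPattern r (Literature.Probability.PointProcesses.reroot (Literature.Probability.PointProcesses.ballPattern ρ S) v)) - g (-v) (Literature.Probability.PointProcesses.ballPattern r (Literature.Probability.PointProcesses.reroot (Literature.Probability.PointProcesses.ballPattern ρ S) v)) (Literature.Probability.PointProcesses.ballPattern r (Literature.Probability.PointProcesses.ballPattern ρ S)))) =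
        ∑ v ∈ Literature.Probability.PointProcesses.lens r' L S, ((fun v p q => if ‖v‖ ≤ ρ - r then g v (Literature.Probability.PointProcesses.ballPattern r p) (Literature.Probability.PointProcesses.ballPattern r q) else 0) v (Literature.Probability.PointProcesses.ballPattern r' S) (Literature.Probability.PointProcesses.ballPattern r' (Literature.Probability.PointProcesses.reroot S v)) - (fun v p q => if ‖v‖ ≤ ρ - r then g v (Literature.Probability.PointProcesses.ballPattern r p) (Literature.Probability.PointProcesses.ballPattern r q) else 0) (-v) (Literature.Probability.PointProcesses.ballPattern r' (Literature.Probability.PointProcesses.reroot S v)) (Literature.Probability.PointProcesses.ballPattern r' S)) := by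
  exact Summit.AtomisticToContinuum.Crystallization.Theorems.PatternPricedCertificates.stub_levelRestrict



/-! ## Tool stubs (wave 2, all LANDED p156893 p157096 p156788): periodic configurations are point-stationary mean families -/

/-- **Tool stub T1 (periodic configurations rooted uniformly over the motif are mean families).** For a periodic configuration `Q` of `ℝ³` whose point set is `δ`-separated, the functional `ℓ_Q ρ f := (#motif)⁻¹ Σ_{x ∈ motif} f (pattern of Q at x within ρ)` (the rooted `ρ`-pattern at `x` is `{y − x | y ∈ Q.points, y ≠ x, dist y x ≤ ρ}`) is additive, homogeneous, nonnegative on `[0,1]`-valued functionals on `(δ, ρ)`-admissible patterns, normalised, and projective (`B_ρ` of the `ρ'`-pattern is the `ρ`-pattern). Lens-consistency is T2. [folklore] -/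
theorem stub_periodicMeanFamily :
    ∀ (δ : ℝ) (Q : Literature.MathematicalPhysics.StatisticalMechanics.PeriodicConfiguration 3), 0 < δ → (∀ x ∈ Q.points, ∀ y ∈ Q.points, x ≠ y → δ ≤ dist x y) →
      (∀ (ρ : ℝ) (f₁ f₂ : Finset (EuclideanSpace ℝ (Fin 3)) → ℝ),
        ((Q.motif.card : ℝ)⁻¹ * ∑ x ∈ Q.motif, (f₁ + f₂) (((Literature.MathematicalPhysics.StatisticalMechanics.PeriodicConfiguration.finite_inter_points Q (Metric.isBounded_closedBall (x := x) (r := ρ))).toFinset.erase x).image (fun y => y - x))) =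
        ((Q.motif.card : ℝ)⁻¹ * ∑ x ∈ Q.motif, f₁ (((Literature.MathematicalPhysics.StatisticalMechanics.PeriodicConfiguration.finite_inter_points Q (Metric.isBounded_closedBall (x := x) (r := ρ))).toFinset.erase x).image (fun y => y - x))) +
        ((Q.motif.card : ℝ)⁻¹ * ∑ x ∈ Q.motif, f₂ (((Literature.MathematicalPhysics.StatisticalMechanics.PeriodicConfiguration.finite_inter_points Q (Metric.isBounded_closedBall (x := x) (r := ρ))).toFinset.erase x).image (fun y => y - x)))) ∧
      (∀ (ρ t : ℝ) (f : Finset (EuclideanSpace ℝ (Fin 3)) → ℝ),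
        ((Q.motif.card : ℝ)⁻¹ * ∑ x ∈ Q.motif, (t • f) (((Literature.MathematicalPhysics.StatisticalMechanics.PeriodicConfiguration.finite_inter_points Q (Metric.isBounded_closedBall (x := x) (r := ρ))).toFinset.erase x).image (fun y => y - x))) =
        t * ((Q.motif.card : ℝ)⁻¹ * ∑ x ∈ Q.motif, f (((Literature.MathematicalPhysics.StatisticalMechanics.PeriodicConfiguration.finite_inter_points Q (Metric.isBounded_closedBall (x := x) (r := ρ))).toFinset.erase x).image (fun y => y - x)))) ∧
      (∀ (ρ : ℝ) (f : Finset (EuclideanSpace ℝ (Fin 3)) → ℝ), (∀ S : Finset (EuclideanSpace ℝ (Fin 3)), Literature.Probability.PointProcesses.IsRootedPattern δ ρ S → 0 ≤ f S ∧ f S ≤ 1) →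
        0 ≤ ((Q.motif.card : ℝ)⁻¹ * ∑ x ∈ Q.motif, f (((Literature.MathematicalPhysics.StatisticalMechanics.PeriodicConfiguration.finite_inter_points Q (Metric.isBounded_closedBall (x := x) (r := ρ))).toFinset.erase x).image (fun y => y - x)))) ∧
      (∀ ρ : ℝ, ((Q.motif.card : ℝ)⁻¹ * ∑ x ∈ Q.motif, (fun _ => (1 : ℝ)) (((Literature.MathematicalPhysics.StatisticalMechanics.PeriodicConfiguration.finite_inter_points Q (Metric.isBounded_closedBall (x := x) (r := ρ))).toFinset.erase x).image (fun y => y - x))) = 1) ∧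
      (∀ ρ ρ' : ℝ, ρ ≤ ρ' → ∀ f : Finset (EuclideanSpace ℝ (Fin 3)) → ℝ,
        ((Q.motif.card : ℝ)⁻¹ * ∑ x ∈ Q.motif, (fun S => f (Literature.Probability.PointProcesses.ballPattern ρ S)) (((Literature.MathematicalPhysics.StatisticalMechanics.PeriodicConfiguration.finite_inter_points Q (Metric.isBounded_closedBall (x := x) (r := ρ'))).toFinset.erase x).image (fun y => y - x))) =
        ((Q.motif.card : ℝ)⁻¹ * ∑ x ∈ Q.motif, f (((Literature.MathematicalPhysics.StatisticalMechanics.PeriodicConfiguration.finite_inter_points Q (Metric.isBounded_closedBall (x := x) (r := ρ))).toFinset.erase x).image (fun y => y - x)))) := by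
  exact Summit.AtomisticToContinuum.Crystallization.Theorems.PatternPricedCertificates.stub_periodicMeanFamily

/-- **Tool stub T2 (unimodularity of periodic configurations: transports vanish on average over the motif).** For every periodic `Q`, every level `(r, ρ)` with `0 ≤ r` and every rule `g`, `Σ_{x ∈ motif} T^{(r,ρ)}_g (pattern of Q at x within ρ) = 0`: for `y ∈ Q.points` with `0 < ‖y − x‖ ≤ ρ − r` the `r`-ball of the pattern at `x` re-rooted at `y − x` is the `r`-pattern at `y`, patterns are invariant under the lattice, and the map `(x, y₀ + γ) ↦ (y₀, x − γ)` is a bijection of the finite set of pairs `(x ∈ motif, y ∈ Q.points, 0 < ‖y − x‖ ≤ ρ − r)` exchanging `g(y − x, ·, ·)` and `g(x − y, ·, ·)` (mass transport for periodic graphs, Aldous–Lyons). [folklore] -/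
theorem stub_periodicTransport :
    ∀ (Q : Literature.MathematicalPhysics.StatisticalMechanics.PeriodicConfiguration 3) (r ρ : ℝ), 0 ≤ r → ∀ g : EuclideanSpace ℝ (Fin 3) → Finset (EuclideanSpace ℝ (Fin 3)) → Finset (EuclideanSpace ℝ (Fin 3)) → ℝ,
      ∑ x ∈ Q.motif, (fun S : Finset (EuclideanSpace ℝ (Fin 3)) => ∑ v ∈ Literature.Probability.PointProcesses.lens r ρ S, (g v (Literature.Probability.PointProcesses.ballPattern r S) (Literature.Probability.PointProcesses.ballPattern r (Literature.Probability.PointProcesses.reroot S v)) - g (-v) (Literature.Probability.PointProcesses.ballPattern r (Literature.Probability.PointProcesses.reroot S v)) (Literature.Probability.PointProcesses.ballPattern r S)))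
        (((Literature.MathematicalPhysics.StatisticalMechanics.PeriodicConfiguration.finite_inter_points Q (Metric.isBounded_closedBall (x := x) (r := ρ))).toFinset.erase x).image (fun y => y - x)) = 0 := by
  exact Summit.AtomisticToContinuum.Crystallization.Theorems.PatternPricedCertificates.stub_periodicTransport

/-- **Tool stub T3 (truncated energies converge to the energy per particle).** For every periodic `Q` of `ℝ³`, `(#motif)⁻¹ Σ_{x ∈ motif} ½ Σ_{v ∈ pattern at x within ρ} V_LJ ‖v‖ → e(Q)` as `ρ → ∞` (`hasSum_lennardJones_dist_three`: the one-centre sums are absolutely summable; balls exhaust the point set). [folklore] -/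
theorem stub_periodicTruncatedEnergy :
    ∀ Q : Literature.MathematicalPhysics.StatisticalMechanics.PeriodicConfiguration 3,
      Filter.Tendsto (fun ρ : ℝ => (Q.motif.card : ℝ)⁻¹ * ∑ x ∈ Q.motif, (∑ v ∈ (((Literature.MathematicalPhysics.StatisticalMechanics.PeriodicConfiguration.finite_inter_points Q (Metric.isBounded_closedBall (x := x) (r := ρ))).toFinset.erase x).image (fun y => y - x)), Literature.MathematicalPhysics.StatisticalMechanics.lennardJones ‖v‖) / 2)
        Filter.atTop (nhds (Q.energyPerParticle Literature.MathematicalPhysics.StatisticalMechanics.lennardJones)) := by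
  exact Summit.AtomisticToContinuum.Crystallization.Theorems.PatternPricedCertificates.stub_periodicTruncatedEnergy

/-! ## Layer-2 lemmas: all landed (`levelLift_mean_*`, `levelLift_abs_sum_le`, `meanDuality_card_le` in the stub files) -/

/-! ## Assembly lemmas (sorry-free) -/

section Helpers

variable {N : ℕ}

/-- Separated configurations are injective. [folklore] -/
theorem injective_of_separated {δ : ℝ} (hδ : 0 < δ) {x : Fin N → EuclideanSpace ℝ (Fin 3)}
    (hx : ∀ i j : Fin N, i ≠ j → δ ≤ dist (x i) (x j)) : Function.Injective x := by
  intro k l hkl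
  by_contra hne
  have h := hx k l hne
  rw [hkl, dist_self] at h
  exact absurd h (not_le.2 hδ)

/-- The truncated one-centre sum over the `L`-pattern is the truncated site sum: `Σ_{v ∈ P_L i} f ‖v‖ =
Σ_{j ≠ i, |x_i − x_j| ≤ L} f |x_i − x_j|` for an injective configuration. [folklore] -/
theorem sum_relPattern_eq (f : ℝ → ℝ) (L : ℝ) {x : Fin N → EuclideanSpace ℝ (Fin 3)}
    (hx : Function.Injective x) (i : Fin N) :
    ∑ v ∈ Literature.MathematicalPhysics.StatisticalMechanics.relPattern L x i, f ‖v‖ =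
      ∑ j ∈ (Finset.univ.erase i).filter (fun j => dist (x i) (x j) ≤ L), f (dist (x i) (x j)) := by
  unfold Literature.MathematicalPhysics.StatisticalMechanics.relPattern
  rw [Finset.sum_image]
  · have hs : (Finset.univ.filter fun k : Fin N => k ≠ i ∧ dist (x i) (x k) ≤ L) =
        (Finset.univ.erase i).filter (fun j => dist (x i) (x j) ≤ L) := by
      ext k
      simp only [Finset.mem_filter, Finset.mem_univ, true_and, Finset.mem_erase, and_true]
    rw [hs]
    refine Finset.sum_congr rfl fun k _ => ?_
    rw [← dist_eq_norm, dist_comm]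
  · intro k _ l _ hkl
    exact hx (sub_left_injective hkl)

/-- **Pattern form of the defect predicate.** For `0 ≤ R`, `0 ≤ ε`, `R + ε ≤ L`, the crux's particle-form
`(R, ε)`-matching predicate at particle `i` (test particles `j : Fin N`) coincides with the pattern form on
the rooted `L`-pattern of `i` with the root adjoined (`insert 0 (relPattern L x i)`): a particle matched to
`x_i + A p`, `‖p‖ ≤ R`, lies within `R + ε ≤ L` of `x_i` (`‖A p‖ = ‖p‖`). [folklore] -/
theorem good_iff (P : Literature.MathematicalPhysics.StatisticalMechanics.PeriodicConfiguration 3)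
    {R ε L : ℝ} (hR : 0 ≤ R) (hε : 0 ≤ ε) (hRL : R + ε ≤ L)
    (x : Fin N → EuclideanSpace ℝ (Fin 3)) (i : Fin N) :
    (∃ A : EuclideanSpace ℝ (Fin 3) →ₗᵢ[ℝ] EuclideanSpace ℝ (Fin 3),
        (∀ p ∈ P.points, ‖p‖ ≤ R → ∃ j : Fin N, dist (x j) (x i + A p) ≤ ε) ∧
        (∀ j : Fin N, dist (x j) (x i) ≤ R → ∃ p ∈ P.points, dist (x j) (x i + A p) ≤ ε)) ↔
    (∃ A : EuclideanSpace ℝ (Fin 3) →ₗᵢ[ℝ] EuclideanSpace ℝ (Fin 3),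
        (∀ p ∈ P.points, ‖p‖ ≤ R →
          ∃ v ∈ insert (0 : EuclideanSpace ℝ (Fin 3))
            (Literature.MathematicalPhysics.StatisticalMechanics.relPattern L x i), dist v (A p) ≤ ε) ∧
        (∀ v ∈ insert (0 : EuclideanSpace ℝ (Fin 3))
            (Literature.MathematicalPhysics.StatisticalMechanics.relPattern L x i),
          ‖v‖ ≤ R → ∃ p ∈ P.points, dist v (A p) ≤ ε)) := by
  have hL0 : 0 ≤ L := by linarith
  -- membership in the rooted pattern with the root adjoined
  have hmem : ∀ j : Fin N, dist (x i) (x j) ≤ L →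
      x j - x i ∈ insert (0 : EuclideanSpace ℝ (Fin 3))
        (Literature.MathematicalPhysics.StatisticalMechanics.relPattern L x i) := by
    intro j hj
    by_cases hji : j = i
    · subst hji
      simp
    · refine Finset.mem_insert_of_mem (Finset.mem_image.2 ⟨j, ?_, rfl⟩)
      simp [hji, hj]
  have hmem' : ∀ v ∈ insert (0 : EuclideanSpace ℝ (Fin 3))
      (Literature.MathematicalPhysics.StatisticalMechanics.relPattern L x i),
      ∃ j : Fin N, dist (x i) (x j) ≤ L ∧ v = x j - x i := by
    intro v hv
    rcases Finset.mem_insert.1 hv with rfl | hv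
    · exact ⟨i, by rw [dist_self]; exact hL0, (sub_self _).symm⟩
    · obtain ⟨k, hk, rfl⟩ := Finset.mem_image.1 hv
      simp only [Finset.mem_filter, Finset.mem_univ, true_and] at hk
      exact ⟨k, hk.2, rfl⟩
  -- the displacement identity
  have hdist : ∀ (j : Fin N) (A : EuclideanSpace ℝ (Fin 3) →ₗᵢ[ℝ] EuclideanSpace ℝ (Fin 3))
      (p : EuclideanSpace ℝ (Fin 3)), dist (x j) (x i + A p) = dist (x j - x i) (A p) := by
    intro j A p
    rw [dist_eq_norm, dist_eq_norm, sub_add_eq_sub_sub]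
  have hAp : ∀ (A : EuclideanSpace ℝ (Fin 3) →ₗᵢ[ℝ] EuclideanSpace ℝ (Fin 3))
      (p : EuclideanSpace ℝ (Fin 3)), dist (x i + A p) (x i) = ‖p‖ := by
    intro A p
    rw [dist_eq_norm, add_sub_cancel_left, A.norm_map]
  constructor
  · rintro ⟨A, h1, h2⟩
    refine ⟨A, fun p hp hpR => ?_, fun v hv hvR => ?_⟩
    · obtain ⟨j, hj⟩ := h1 p hp hpR
      refine ⟨x j - x i, hmem j ?_, by rwa [← hdist]⟩
      calc dist (x i) (x j) = dist (x j) (x i) := dist_comm _ _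
        _ ≤ dist (x j) (x i + A p) + dist (x i + A p) (x i) := dist_triangle _ _ _
        _ ≤ ε + ‖p‖ := by rw [hAp]; linarith
        _ ≤ L := by linarith
    · obtain ⟨j, hjL, rfl⟩ := hmem' v hv
      have hjR : dist (x j) (x i) ≤ R := by rwa [dist_eq_norm]
      obtain ⟨p, hp, hjp⟩ := h2 j hjR
      exact ⟨p, hp, by rwa [← hdist]⟩
  · rintro ⟨A, h1, h2⟩
    refine ⟨A, fun p hp hpR => ?_, fun j hjR => ?_⟩
    · obtain ⟨v, hv, hvp⟩ := h1 p hp hpR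
      obtain ⟨j, -, rfl⟩ := hmem' v hv
      exact ⟨j, by rwa [hdist]⟩
    · have hjL : dist (x i) (x j) ≤ L := by rw [dist_comm]; linarith
      have hvR : ‖x j - x i‖ ≤ R := by rwa [← dist_eq_norm]
      obtain ⟨p, hp, hvp⟩ := h2 (x j - x i) (hmem j hjL) hvR
      exact ⟨p, hp, by rwa [hdist]⟩

end Helpers


/-! ## The birth stub statements as named propositions (the dual certificate is now DERIVED, see `dualCertificates_of`) -/

/-- The birth line's dual stub `stub_patternCertificates` (finite-level pattern-pointwise priced certificate), kept verbatim as a proposition; no longer a stub: it is derived from stubs A, B, C by `dualCertificates_of`. [conjecture] -/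
def Sig.stub_patternCertificates : Prop :=
  ∃ P : Literature.MathematicalPhysics.StatisticalMechanics.PeriodicConfiguration 3, ∀ δ R ε θ : ℝ, 0 < δ → 0 < R → 0 < ε → 0 < θ →
      ∃ κ : ℝ, 0 < κ ∧ κ ≤ 1 ∧ ∀ L₀ : ℝ,
        ∃ (L r c : ℝ) (g : EuclideanSpace ℝ (Fin 3) → Finset (EuclideanSpace ℝ (Fin 3)) → Finset (EuclideanSpace ℝ (Fin 3)) → ℝ)
          (Q : Literature.MathematicalPhysics.StatisticalMechanics.PeriodicConfiguration 3),
          L₀ ≤ L ∧ R + ε ≤ L ∧ 0 ≤ r ∧ r ≤ L ∧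
          Q.energyPerParticle Literature.MathematicalPhysics.StatisticalMechanics.lennardJones ≤ c + κ * θ ∧
          ∀ S : Finset (EuclideanSpace ℝ (Fin 3)), Literature.Probability.PointProcesses.IsRootedPattern δ L S →
            c + (if (∃ A : EuclideanSpace ℝ (Fin 3) →ₗᵢ[ℝ] EuclideanSpace ℝ (Fin 3),
                    (∀ p ∈ P.points, ‖p‖ ≤ R → ∃ v ∈ insert (0 : EuclideanSpace ℝ (Fin 3)) S, dist v (A p) ≤ ε) ∧
                    (∀ v ∈ insert (0 : EuclideanSpace ℝ (Fin 3)) S, ‖v‖ ≤ R → ∃ p ∈ P.points, dist v (A p) ≤ ε))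
                  then 0 else κ)
              ≤ (∑ v ∈ S, Literature.MathematicalPhysics.StatisticalMechanics.lennardJones ‖v‖) / 2 +
                ∑ v ∈ Literature.Probability.PointProcesses.lens r L S,
                  (g v (Literature.Probability.PointProcesses.ballPattern r S) (Literature.Probability.PointProcesses.ballPattern r (Literature.Probability.PointProcesses.reroot S v)) -
                    g (-v) (Literature.Probability.PointProcesses.ballPattern r (Literature.Probability.PointProcesses.reroot S v)) (Literature.Probability.PointProcesses.ballPattern r S))

/-- Statement of `stub_lensLift` (verbatim). [folklore] -/
def Sig.stub_lensLift : Prop :=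
  ∀ (δ r L : ℝ), 0 < δ → 0 ≤ r → r ≤ L →
      ∀ (F : Finset (EuclideanSpace ℝ (Fin 3)) → ℝ) (g : EuclideanSpace ℝ (Fin 3) → Finset (EuclideanSpace ℝ (Fin 3)) → Finset (EuclideanSpace ℝ (Fin 3)) → ℝ),
        (∀ S : Finset (EuclideanSpace ℝ (Fin 3)), Literature.Probability.PointProcesses.IsRootedPattern δ L S →
          F S ≤ ∑ v ∈ Literature.Probability.PointProcesses.lens r L S,
            (g v (Literature.Probability.PointProcesses.ballPattern r S) (Literature.Probability.PointProcesses.ballPattern r (Literature.Probability.PointProcesses.reroot S v)) -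
              g (-v) (Literature.Probability.PointProcesses.ballPattern r (Literature.Probability.PointProcesses.reroot S v)) (Literature.Probability.PointProcesses.ballPattern r S))) →
        ∀ (N : ℕ) (x : Fin N → EuclideanSpace ℝ (Fin 3)), (∀ i j : Fin N, i ≠ j → δ ≤ dist (x i) (x j)) →
          ∀ i : Fin N, F (Literature.MathematicalPhysics.StatisticalMechanics.relPattern L x i) ≤ ∑ j ∈ Finset.univ.erase i,
            ((if ‖x j - x i‖ ≤ L - r then
                g (x j - x i) (Literature.Probability.PointProcesses.ballPattern r (Literature.MathematicalPhysics.StatisticalMechanics.relPattern L x i))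
                  (Literature.Probability.PointProcesses.ballPattern r (Literature.MathematicalPhysics.StatisticalMechanics.relPattern L x j)) else 0) -
             (if ‖x i - x j‖ ≤ L - r then
                g (x i - x j) (Literature.Probability.PointProcesses.ballPattern r (Literature.MathematicalPhysics.StatisticalMechanics.relPattern L x j))
                  (Literature.Probability.PointProcesses.ballPattern r (Literature.MathematicalPhysics.StatisticalMechanics.relPattern L x i)) else 0))

/-- Statement of `stub_farField` (verbatim). [folklore] -/
def Sig.stub_farField : Prop :=
  ∀ δ : ℝ, 0 < δ → ∀ η : ℝ, 0 < η → ∃ L₀ : ℝ, ∀ L : ℝ, L₀ ≤ L →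
      ∀ (N : ℕ) (x : Fin N → EuclideanSpace ℝ (Fin 3)), (∀ i j : Fin N, i ≠ j → δ ≤ dist (x i) (x j)) →
        ∀ i : Fin N, -η ≤ ∑ j ∈ (Finset.univ.erase i).filter (fun j => ¬ dist (x i) (x j) ≤ L),
          Literature.MathematicalPhysics.StatisticalMechanics.lennardJones (dist (x i) (x j))

/-! ## The birth assembly: the crux BY NAME from the dual finite-level certificate (sorry-free, registered 2026-08-17) -/

/-- The crux proposition under a local name, so that the birth assembly below (whose hypothesis is the
DERIVED dual certificate, not a stub) is not mistaken for the skeleton theorem; `PatternPricedCertificates_of`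
is the skeleton theorem and concludes the crux by its tree name. [conjecture] -/
def CruxDecl : Prop :=
  Summit.AtomisticToContinuum.Crystallization.Theses.FrustrationRangeCertificates.PatternPricedCertificates


/-- **Birth assembly.** `Sig.stub_patternCertificates → PatternPricedCertificates` (the route's crux
decl, by name; the landed stubs `stub_lensLift`, `stub_farField` are invoked inside), sorry-free: `P` from stub 1, `δ` from the
proved Literature fact `LennardJonesMinimalDistance_holds`, price `κ` from stub 1 at budget `θ/2`, level
threshold from stub 3 at `η := κθ`, witnesses `(L, r, c, g, Q)` from stub 1, crux constant `c − κθ/2`,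
transfer rule the lens lift of `g`; the certificate is stub 2 applied to
`F(S) := c + κ·1[bad S] − ½ Σ_{v ∈ S} V ‖v‖`, the truncated sum identified with the truncated site energy
(`sum_relPattern_eq`), the defect predicate transported (`good_iff`), the far field bounded by stub 3.
[folklore] -/
theorem PatternPricedCertificates_of_dual (h₁ : Sig.stub_patternCertificates) : CruxDecl := by
  unfold CruxDecl
  -- stubs 2 and 3 are landed Theorems (no longer hypotheses of the skeleton)
  have h₂ : Sig.stub_lensLift := Summit.AtomisticToContinuum.Crystallization.Theorems.PatternPricedCertificates.stub_lensLift
  have h₃ : Sig.stub_farField := Summit.AtomisticToContinuum.Crystallization.Theorems.PatternPricedCertificates.stub_farField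
  obtain ⟨P, hP⟩ := h₁
  obtain ⟨δ, hδ, hGS⟩ := Literature.MathematicalPhysics.StatisticalMechanics.LennardJonesMinimalDistance_holds
  unfold Summit.AtomisticToContinuum.Crystallization.Theses.FrustrationRangeCertificates.PatternPricedCertificates
  refine ⟨P, fun R ε θ hR hε hθ => ?_⟩
  obtain ⟨κ, hκ0, hκ1, hκ⟩ := hP δ R ε (θ / 2) hδ hR hε (half_pos hθ)
  obtain ⟨L₀, hL₀⟩ := h₃ δ hδ (κ * θ) (mul_pos hκ0 hθ)
  obtain ⟨L, r, c, g, Q, hL₀L, hRL, hr0, hrL, hQ, hcert⟩ := hκ L₀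
  refine ⟨δ, L, c - κ * θ / 2, κ,
    fun v p q => if ‖v‖ ≤ L - r then g v (Literature.Probability.PointProcesses.ballPattern r p) (Literature.Probability.PointProcesses.ballPattern r q) else 0,
    Q, hδ, hκ0, hκ1, hGS, by linarith, ?_⟩
  intro N x hx pat i
  have hinj : Function.Injective x := injective_of_separated hδ hx
  -- stub 2 applied to `F S := c + κ·1[bad S] − ½ Σ_{v ∈ S} V ‖v‖`
  have hF := h₂ δ r L hδ hr0 hrL
    (fun S => c + (if (∃ A : EuclideanSpace ℝ (Fin 3) →ₗᵢ[ℝ] EuclideanSpace ℝ (Fin 3),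
        (∀ p ∈ P.points, ‖p‖ ≤ R → ∃ v ∈ insert (0 : EuclideanSpace ℝ (Fin 3)) S, dist v (A p) ≤ ε) ∧
        (∀ v ∈ insert (0 : EuclideanSpace ℝ (Fin 3)) S, ‖v‖ ≤ R → ∃ p ∈ P.points, dist v (A p) ≤ ε)) then (0 : ℝ) else κ) -
      (∑ v ∈ S, Literature.MathematicalPhysics.StatisticalMechanics.lennardJones ‖v‖) / 2)
    g (fun S hS => by have h := hcert S hS; linarith) N x hx i
  beta_reduce at hF
  -- the truncated one-centre sum is the truncated site energy
  rw [sum_relPattern_eq Literature.MathematicalPhysics.StatisticalMechanics.lennardJones L hinj i] at hF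
  -- near/far split of the full site energy and the far-field bound (stub 3)
  have hsplit := Finset.sum_filter_add_sum_filter_not (Finset.univ.erase i)
    (fun j => dist (x i) (x j) ≤ L) (fun j => Literature.MathematicalPhysics.StatisticalMechanics.lennardJones (dist (x i) (x j)))
  beta_reduce at hsplit
  have hfar := hL₀ L hL₀L N x hx i
  -- the defect predicate: particle form (crux) ↔ pattern form (stub 1)
  have hgood := good_iff P hR.le hε.le hRL x i
  -- conclude, up to unfolding `pat i = relPattern L x i` and β-reducing the lifted rule (both `rfl`)
  suffices key : c - κ * θ / 2 + (if (∃ A : EuclideanSpace ℝ (Fin 3) →ₗᵢ[ℝ] EuclideanSpace ℝ (Fin 3),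
        (∀ p ∈ P.points, ‖p‖ ≤ R → ∃ j : Fin N, dist (x j) (x i + A p) ≤ ε) ∧
        (∀ j : Fin N, dist (x j) (x i) ≤ R → ∃ p ∈ P.points, dist (x j) (x i + A p) ≤ ε)) then (0 : ℝ) else κ) ≤
      (∑ j ∈ Finset.univ.erase i, Literature.MathematicalPhysics.StatisticalMechanics.lennardJones (dist (x i) (x j))) / 2 +
        ∑ j ∈ Finset.univ.erase i,
          ((if ‖x j - x i‖ ≤ L - r then
              g (x j - x i) (Literature.Probability.PointProcesses.ballPattern r (Literature.MathematicalPhysics.StatisticalMechanics.relPattern L x i))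
                (Literature.Probability.PointProcesses.ballPattern r (Literature.MathematicalPhysics.StatisticalMechanics.relPattern L x j)) else 0) -
           (if ‖x i - x j‖ ≤ L - r then
              g (x i - x j) (Literature.Probability.PointProcesses.ballPattern r (Literature.MathematicalPhysics.StatisticalMechanics.relPattern L x j))
                (Literature.Probability.PointProcesses.ballPattern r (Literature.MathematicalPhysics.StatisticalMechanics.relPattern L x i)) else 0)) by
    exact key
  by_cases hg : ∃ A : EuclideanSpace ℝ (Fin 3) →ₗᵢ[ℝ] EuclideanSpace ℝ (Fin 3),
      (∀ p ∈ P.points, ‖p‖ ≤ R → ∃ j : Fin N, dist (x j) (x i + A p) ≤ ε) ∧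
      (∀ j : Fin N, dist (x j) (x i) ≤ R → ∃ p ∈ P.points, dist (x j) (x i + A p) ≤ ε)
  · rw [if_pos hg]
    rw [if_pos (hgood.1 hg)] at hF
    linarith
  · rw [if_neg hg]
    rw [if_neg (fun h => hg (hgood.2 h))] at hF
    linarith


/-! ## The new stub statements as named propositions (verbatim the stub signatures) -/

/-- Statement of `stub_stationaryMeansRigidity` (verbatim). [conjecture] -/
def Sig.stub_stationaryMeansRigidity : Prop :=
    ∃ P : Literature.MathematicalPhysics.StatisticalMechanics.PeriodicConfiguration 3, ∀ δ R ε θ : ℝ, 0 < δ → 0 < R → 0 < ε → 0 < θ →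
      ∃ (κ c : ℝ) (Q : Literature.MathematicalPhysics.StatisticalMechanics.PeriodicConfiguration 3), 0 < κ ∧ κ ≤ 1 ∧
        Q.energyPerParticle Literature.MathematicalPhysics.StatisticalMechanics.lennardJones ≤ c + κ * θ ∧
        ∀ ℓ : ℝ → (Finset (EuclideanSpace ℝ (Fin 3)) → ℝ) → ℝ,
          (∀ (ρ : ℝ) (f₁ f₂ : Finset (EuclideanSpace ℝ (Fin 3)) → ℝ), ℓ ρ (f₁ + f₂) = ℓ ρ f₁ + ℓ ρ f₂) →
          (∀ (ρ t : ℝ) (f : Finset (EuclideanSpace ℝ (Fin 3)) → ℝ), ℓ ρ (t • f) = t * ℓ ρ f) →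
          (∀ (ρ : ℝ) (f : Finset (EuclideanSpace ℝ (Fin 3)) → ℝ), (∀ S : Finset (EuclideanSpace ℝ (Fin 3)), Literature.Probability.PointProcesses.IsRootedPattern δ ρ S → 0 ≤ f S ∧ f S ≤ 1) → 0 ≤ ℓ ρ f) →
          (∀ ρ : ℝ, ℓ ρ (fun _ => 1) = 1) →
          (∀ ρ ρ' : ℝ, ρ ≤ ρ' → ∀ f : Finset (EuclideanSpace ℝ (Fin 3)) → ℝ, ℓ ρ' (fun S => f (Literature.Probability.PointProcesses.ballPattern ρ S)) = ℓ ρ f) →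
          (∀ r ρ : ℝ, 0 ≤ r → ∀ g : EuclideanSpace ℝ (Fin 3) → Finset (EuclideanSpace ℝ (Fin 3)) → Finset (EuclideanSpace ℝ (Fin 3)) → ℝ, (∃ M : ℝ, ∀ v p q, |g v p q| ≤ M) →
            ℓ ρ (fun S => ∑ v ∈ Literature.Probability.PointProcesses.lens r ρ S, (g v (Literature.Probability.PointProcesses.ballPattern r S) (Literature.Probability.PointProcesses.ballPattern r (Literature.Probability.PointProcesses.reroot S v)) - g (-v) (Literature.Probability.PointProcesses.ballPattern r (Literature.Probability.PointProcesses.reroot S v)) (Literature.Probability.PointProcesses.ballPattern r S))) = 0) →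
          ∀ ρ : ℝ, R + ε ≤ ρ → 1 ≤ ρ →
            c + κ * ℓ ρ (fun S => (if (∃ A : EuclideanSpace ℝ (Fin 3) →ₗᵢ[ℝ] EuclideanSpace ℝ (Fin 3), (∀ p ∈ P.points, ‖p‖ ≤ R → ∃ v ∈ insert (0 : EuclideanSpace ℝ (Fin 3)) S, dist v (A p) ≤ ε) ∧ (∀ v ∈ insert (0 : EuclideanSpace ℝ (Fin 3)) S, ‖v‖ ≤ R → ∃ p ∈ P.points, dist v (A p) ≤ ε)) then (0 : ℝ) else 1)) ≤
              ℓ ρ (fun S => (∑ v ∈ S, Literature.MathematicalPhysics.StatisticalMechanics.lennardJones ‖v‖) / 2)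

/-- Statement of `stub_levelLift` (verbatim). [folklore] -/
def Sig.stub_levelLift : Prop :=
    ∀ (P : Literature.MathematicalPhysics.StatisticalMechanics.PeriodicConfiguration 3) (δ R ε κ c : ℝ), 0 < δ → 0 < R → 0 < ε →
      (∀ ℓ : ℝ → (Finset (EuclideanSpace ℝ (Fin 3)) → ℝ) → ℝ,
        (∀ (ρ : ℝ) (f₁ f₂ : Finset (EuclideanSpace ℝ (Fin 3)) → ℝ), ℓ ρ (f₁ + f₂) = ℓ ρ f₁ + ℓ ρ f₂) →
        (∀ (ρ t : ℝ) (f : Finset (EuclideanSpace ℝ (Fin 3)) → ℝ), ℓ ρ (t • f) = t * ℓ ρ f) →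
        (∀ (ρ : ℝ) (f : Finset (EuclideanSpace ℝ (Fin 3)) → ℝ), (∀ S : Finset (EuclideanSpace ℝ (Fin 3)), Literature.Probability.PointProcesses.IsRootedPattern δ ρ S → 0 ≤ f S ∧ f S ≤ 1) → 0 ≤ ℓ ρ f) →
        (∀ ρ : ℝ, ℓ ρ (fun _ => 1) = 1) →
        (∀ ρ ρ' : ℝ, ρ ≤ ρ' → ∀ f : Finset (EuclideanSpace ℝ (Fin 3)) → ℝ, ℓ ρ' (fun S => f (Literature.Probability.PointProcesses.ballPattern ρ S)) = ℓ ρ f) →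
        (∀ r ρ : ℝ, 0 ≤ r → ∀ g : EuclideanSpace ℝ (Fin 3) → Finset (EuclideanSpace ℝ (Fin 3)) → Finset (EuclideanSpace ℝ (Fin 3)) → ℝ, (∃ M : ℝ, ∀ v p q, |g v p q| ≤ M) →
          ℓ ρ (fun S => ∑ v ∈ Literature.Probability.PointProcesses.lens r ρ S, (g v (Literature.Probability.PointProcesses.ballPattern r S) (Literature.Probability.PointProcesses.ballPattern r (Literature.Probability.PointProcesses.reroot S v)) - g (-v) (Literature.Probability.PointProcesses.ballPattern r (Literature.Probability.PointProcesses.reroot S v)) (Literature.Probability.PointProcesses.ballPattern r S))) = 0) →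
        ∀ ρ : ℝ, R + ε ≤ ρ → 1 ≤ ρ →
          c + κ * ℓ ρ (fun S => (if (∃ A : EuclideanSpace ℝ (Fin 3) →ₗᵢ[ℝ] EuclideanSpace ℝ (Fin 3), (∀ p ∈ P.points, ‖p‖ ≤ R → ∃ v ∈ insert (0 : EuclideanSpace ℝ (Fin 3)) S, dist v (A p) ≤ ε) ∧ (∀ v ∈ insert (0 : EuclideanSpace ℝ (Fin 3)) S, ‖v‖ ≤ R → ∃ p ∈ P.points, dist v (A p) ≤ ε)) then (0 : ℝ) else 1)) ≤
            ℓ ρ (fun S => (∑ v ∈ S, Literature.MathematicalPhysics.StatisticalMechanics.lennardJones ‖v‖) / 2)) →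
      ∀ η : ℝ, 0 < η → ∀ L₀ : ℝ, ∃ L r : ℝ, L₀ ≤ L ∧ R + ε ≤ L ∧ 0 ≤ r ∧ r ≤ L ∧
        ∀ m : (Finset (EuclideanSpace ℝ (Fin 3)) → ℝ) → ℝ,
          (∀ f₁ f₂ : Finset (EuclideanSpace ℝ (Fin 3)) → ℝ, m (f₁ + f₂) = m f₁ + m f₂) →
          (∀ (t : ℝ) (f : Finset (EuclideanSpace ℝ (Fin 3)) → ℝ), m (t • f) = t * m f) →
          (∀ f : Finset (EuclideanSpace ℝ (Fin 3)) → ℝ, (∀ S : Finset (EuclideanSpace ℝ (Fin 3)), Literature.Probability.PointProcesses.IsRootedPattern δ L S → 0 ≤ f S ∧ f S ≤ 1) → 0 ≤ m f) →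
          m (fun _ => 1) = 1 →
          (∀ g : EuclideanSpace ℝ (Fin 3) → Finset (EuclideanSpace ℝ (Fin 3)) → Finset (EuclideanSpace ℝ (Fin 3)) → ℝ, (∃ M : ℝ, ∀ v p q, |g v p q| ≤ M) →
            m (fun S => ∑ v ∈ Literature.Probability.PointProcesses.lens r L S, (g v (Literature.Probability.PointProcesses.ballPattern r S) (Literature.Probability.PointProcesses.ballPattern r (Literature.Probability.PointProcesses.reroot S v)) - g (-v) (Literature.Probability.PointProcesses.ballPattern r (Literature.Probability.PointProcesses.reroot S v)) (Literature.Probability.PointProcesses.ballPattern r S))) = 0) →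
          c - η + κ * m (fun S => (if (∃ A : EuclideanSpace ℝ (Fin 3) →ₗᵢ[ℝ] EuclideanSpace ℝ (Fin 3), (∀ p ∈ P.points, ‖p‖ ≤ R → ∃ v ∈ insert (0 : EuclideanSpace ℝ (Fin 3)) S, dist v (A p) ≤ ε) ∧ (∀ v ∈ insert (0 : EuclideanSpace ℝ (Fin 3)) S, ‖v‖ ≤ R → ∃ p ∈ P.points, dist v (A p) ≤ ε)) then (0 : ℝ) else 1)) ≤
            m (fun S => (∑ v ∈ S, Literature.MathematicalPhysics.StatisticalMechanics.lennardJones ‖v‖) / 2)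

/-- Statement of `stub_meanDuality` (verbatim). [folklore] -/
def Sig.stub_meanDuality : Prop :=
    ∀ (δ r L : ℝ), 0 < δ → ∀ a : Finset (EuclideanSpace ℝ (Fin 3)) → ℝ, (∃ M : ℝ, ∀ S : Finset (EuclideanSpace ℝ (Fin 3)), Literature.Probability.PointProcesses.IsRootedPattern δ L S → |a S| ≤ M) →
      (∀ m : (Finset (EuclideanSpace ℝ (Fin 3)) → ℝ) → ℝ,
        (∀ f₁ f₂ : Finset (EuclideanSpace ℝ (Fin 3)) → ℝ, m (f₁ + f₂) = m f₁ + m f₂) →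
        (∀ (t : ℝ) (f : Finset (EuclideanSpace ℝ (Fin 3)) → ℝ), m (t • f) = t * m f) →
        (∀ f : Finset (EuclideanSpace ℝ (Fin 3)) → ℝ, (∀ S : Finset (EuclideanSpace ℝ (Fin 3)), Literature.Probability.PointProcesses.IsRootedPattern δ L S → 0 ≤ f S ∧ f S ≤ 1) → 0 ≤ m f) →
        m (fun _ => 1) = 1 →
        (∀ g : EuclideanSpace ℝ (Fin 3) → Finset (EuclideanSpace ℝ (Fin 3)) → Finset (EuclideanSpace ℝ (Fin 3)) → ℝ, (∃ M : ℝ, ∀ v p q, |g v p q| ≤ M) →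
          m (fun S => ∑ v ∈ Literature.Probability.PointProcesses.lens r L S, (g v (Literature.Probability.PointProcesses.ballPattern r S) (Literature.Probability.PointProcesses.ballPattern r (Literature.Probability.PointProcesses.reroot S v)) - g (-v) (Literature.Probability.PointProcesses.ballPattern r (Literature.Probability.PointProcesses.reroot S v)) (Literature.Probability.PointProcesses.ballPattern r S))) = 0) →
        0 ≤ m a) →
      ∀ η : ℝ, 0 < η → ∃ g : EuclideanSpace ℝ (Fin 3) → Finset (EuclideanSpace ℝ (Fin 3)) → Finset (EuclideanSpace ℝ (Fin 3)) → ℝ, (∃ M : ℝ, ∀ v p q, |g v p q| ≤ M) ∧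
        ∀ S : Finset (EuclideanSpace ℝ (Fin 3)), Literature.Probability.PointProcesses.IsRootedPattern δ L S →
          -η ≤ a S + ∑ v ∈ Literature.Probability.PointProcesses.lens r L S, (g v (Literature.Probability.PointProcesses.ballPattern r S) (Literature.Probability.PointProcesses.ballPattern r (Literature.Probability.PointProcesses.reroot S v)) - g (-v) (Literature.Probability.PointProcesses.ballPattern r (Literature.Probability.PointProcesses.reroot S v)) (Literature.Probability.PointProcesses.ballPattern r S))



/-! ## Tool stub statements as named propositions -/

/-- Statement of `stub_periodicMeanFamily` (verbatim). [folklore] -/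
def Sig.stub_periodicMeanFamily : Prop :=
    ∀ (δ : ℝ) (Q : Literature.MathematicalPhysics.StatisticalMechanics.PeriodicConfiguration 3), 0 < δ → (∀ x ∈ Q.points, ∀ y ∈ Q.points, x ≠ y → δ ≤ dist x y) →
      (∀ (ρ : ℝ) (f₁ f₂ : Finset (EuclideanSpace ℝ (Fin 3)) → ℝ),
        ((Q.motif.card : ℝ)⁻¹ * ∑ x ∈ Q.motif, (f₁ + f₂) (((Literature.MathematicalPhysics.StatisticalMechanics.PeriodicConfiguration.finite_inter_points Q (Metric.isBounded_closedBall (x := x) (r := ρ))).toFinset.erase x).image (fun y => y - x))) =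
        ((Q.motif.card : ℝ)⁻¹ * ∑ x ∈ Q.motif, f₁ (((Literature.MathematicalPhysics.StatisticalMechanics.PeriodicConfiguration.finite_inter_points Q (Metric.isBounded_closedBall (x := x) (r := ρ))).toFinset.erase x).image (fun y => y - x))) +
        ((Q.motif.card : ℝ)⁻¹ * ∑ x ∈ Q.motif, f₂ (((Literature.MathematicalPhysics.StatisticalMechanics.PeriodicConfiguration.finite_inter_points Q (Metric.isBounded_closedBall (x := x) (r := ρ))).toFinset.erase x).image (fun y => y - x)))) ∧
      (∀ (ρ t : ℝ) (f : Finset (EuclideanSpace ℝ (Fin 3)) → ℝ),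
        ((Q.motif.card : ℝ)⁻¹ * ∑ x ∈ Q.motif, (t • f) (((Literature.MathematicalPhysics.StatisticalMechanics.PeriodicConfiguration.finite_inter_points Q (Metric.isBounded_closedBall (x := x) (r := ρ))).toFinset.erase x).image (fun y => y - x))) =
        t * ((Q.motif.card : ℝ)⁻¹ * ∑ x ∈ Q.motif, f (((Literature.MathematicalPhysics.StatisticalMechanics.PeriodicConfiguration.finite_inter_points Q (Metric.isBounded_closedBall (x := x) (r := ρ))).toFinset.erase x).image (fun y => y - x)))) ∧
      (∀ (ρ : ℝ) (f : Finset (EuclideanSpace ℝ (Fin 3)) → ℝ), (∀ S : Finset (EuclideanSpace ℝ (Fin 3)), Literature.Probability.PointProcesses.IsRootedPattern δ ρ S → 0 ≤ f S ∧ f S ≤ 1) →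
        0 ≤ ((Q.motif.card : ℝ)⁻¹ * ∑ x ∈ Q.motif, f (((Literature.MathematicalPhysics.StatisticalMechanics.PeriodicConfiguration.finite_inter_points Q (Metric.isBounded_closedBall (x := x) (r := ρ))).toFinset.erase x).image (fun y => y - x)))) ∧
      (∀ ρ : ℝ, ((Q.motif.card : ℝ)⁻¹ * ∑ x ∈ Q.motif, (fun _ => (1 : ℝ)) (((Literature.MathematicalPhysics.StatisticalMechanics.PeriodicConfiguration.finite_inter_points Q (Metric.isBounded_closedBall (x := x) (r := ρ))).toFinset.erase x).image (fun y => y - x))) = 1) ∧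
      (∀ ρ ρ' : ℝ, ρ ≤ ρ' → ∀ f : Finset (EuclideanSpace ℝ (Fin 3)) → ℝ,
        ((Q.motif.card : ℝ)⁻¹ * ∑ x ∈ Q.motif, (fun S => f (Literature.Probability.PointProcesses.ballPattern ρ S)) (((Literature.MathematicalPhysics.StatisticalMechanics.PeriodicConfiguration.finite_inter_points Q (Metric.isBounded_closedBall (x := x) (r := ρ'))).toFinset.erase x).image (fun y => y - x))) =
        ((Q.motif.card : ℝ)⁻¹ * ∑ x ∈ Q.motif, f (((Literature.MathematicalPhysics.StatisticalMechanics.PeriodicConfiguration.finite_inter_points Q (Metric.isBounded_closedBall (x := x) (r := ρ))).toFinset.erase x).image (fun y => y - x))))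

/-- Statement of `stub_periodicTransport` (verbatim). [folklore] -/
def Sig.stub_periodicTransport : Prop :=
    ∀ (Q : Literature.MathematicalPhysics.StatisticalMechanics.PeriodicConfiguration 3) (r ρ : ℝ), 0 ≤ r → ∀ g : EuclideanSpace ℝ (Fin 3) → Finset (EuclideanSpace ℝ (Fin 3)) → Finset (EuclideanSpace ℝ (Fin 3)) → ℝ,
      ∑ x ∈ Q.motif, (fun S : Finset (EuclideanSpace ℝ (Fin 3)) => ∑ v ∈ Literature.Probability.PointProcesses.lens r ρ S, (g v (Literature.Probability.PointProcesses.ballPattern r S) (Literature.Probability.PointProcesses.ballPattern r (Literature.Probability.PointProcesses.reroot S v)) - g (-v) (Literature.Probability.PointProcesses.ballPattern r (Literature.Probability.PointProcesses.reroot S v)) (Literature.Probability.PointProcesses.ballPattern r S)))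
        (((Literature.MathematicalPhysics.StatisticalMechanics.PeriodicConfiguration.finite_inter_points Q (Metric.isBounded_closedBall (x := x) (r := ρ))).toFinset.erase x).image (fun y => y - x)) = 0

/-- Statement of `stub_periodicTruncatedEnergy` (verbatim). [folklore] -/
def Sig.stub_periodicTruncatedEnergy : Prop :=
    ∀ Q : Literature.MathematicalPhysics.StatisticalMechanics.PeriodicConfiguration 3,
      Filter.Tendsto (fun ρ : ℝ => (Q.motif.card : ℝ)⁻¹ * ∑ x ∈ Q.motif, (∑ v ∈ (((Literature.MathematicalPhysics.StatisticalMechanics.PeriodicConfiguration.finite_inter_points Q (Metric.isBounded_closedBall (x := x) (r := ρ))).toFinset.erase x).image (fun y => y - x)), Literature.MathematicalPhysics.StatisticalMechanics.lennardJones ‖v‖) / 2)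
        Filter.atTop (nhds (Q.energyPerParticle Literature.MathematicalPhysics.StatisticalMechanics.lennardJones))


/-! ## Reshape v6 (lead c1): the priced core from a QUALITATIVE core and the unpriced energy bound

`stub_stationaryMeansRigidity` (priced, with budget bookkeeping `κ, c, Q, θ`) is DERIVED from
* `stub_qualitativeMeansRigidity` — ∃ periodic `P` such that every point-stationary mean family of
  MINIMAL energy (`inf_ρ ℓ ρ (½h_ρ) ≤ e⋆ := ⨅_Q e(Q)`) is `P`-patterned at every scale
  (`ℓ (bad_{P,R,ε}) = 0` for all `R, ε`): the finitely additive Palm rigidity, no price, no budget —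
  THE open core in its cleanest form; and
* `stub_unpricedMeanBound` — every point-stationary mean family has energy per particle `≥ e⋆`
  (`e⋆ ≤ ℓ ρ (½ h_ρ)` for `ρ ≥ 1`): "no duality gap at `κ = 0`", believed provable (Følner /
  allocation argument), the unpriced half of the route's TransferDuality,
by COMPACTNESS, which for means is again an ultralimit: if no price `κ = 1/(n+2)` works (with
`Q_n` near-optimal, `c_n = e(Q_n) − κ_n θ`), the violating families `ℓ_n` have defect mass `b_n > θ/2`
(by the unpriced bound) and energies `≤ e⋆ + O(κ_n) + t_ρ/2` at every radius; their Banach limit is a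
point-stationary family of minimal energy with defect mass `≥ θ/2`, contradicting the qualitative core.
-/

section ReshapeV6

open Literature.Probability.PointProcesses (IsRootedPattern ballPattern lens reroot)
open Literature.MathematicalPhysics.StatisticalMechanics (lennardJones PeriodicConfiguration)
open Summit.AtomisticToContinuum.Crystallization.Theorems.PatternPricedCertificates
  (levelLift_mean_sub levelLift_mean_const levelLift_mean_mono levelLift_mean_mem_Icc
    levelLift_abs_sum_le levelLift_isRootedPattern_ballPattern levelLift_good_ballPattern_iff)


/-! ## Reshape v7 (lead c2): `stub_unpricedMeanBound` from the SHIFT-AVERAGED CUBE-PARTITION TRANSPORT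

For a side `s` and an offset `u ∈ [0,s)³`, partition `ℝ³` into the cubes of `sℤ³ + u`; the rule "every point
sends `χ(x)/N` to every point `x` of its own cube" (`N` = number of configuration points in that cube,
`χ = ½h_ρ + (1/24)·#{attractive cross-cube neighbours within ρ}`), AVERAGED over `u` (the offset seen from a
point `v` is `u − v`; the `u`-average of an `sℤ³`-periodic integrand is shift invariant, `stub_boxIntegral_shift`),
is a bounded pattern-local transport at range `r = 2s + ρ`; its transport functional is EXACTLY
`⨍_u [cube average of χ − χ(root)]` (`stub_cubeTransport`: both endpoints of a same-cube pair normalise by the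
same count); inside one cube the finite-cluster bound `Σ_{x ∈ Y} χ(x) ≥ |Y| e⋆` holds pointwise
(`stub_clusterEnergyBound`: `N e⋆ ≤ E(Y)` by periodisation, `V_LJ ≤ 0` beyond `1`, each cross pair costs `≤ 1/12`);
and `⨍_u χ(root) ≤ ½h_ρ(root) + (1/24)·#B_ρ·3ρ/s` (`stub_boxIntegral_faceCrossing`). The mass-transport identity
`ℓ(T_g) = 0` then gives `e⋆ − C(δ,ρ)/s ≤ ℓ ρ (½h_ρ)` for every `s`, whence the stub. No σ-additivity, no
Voronoi cells, no ergodic theorem: amenability of `ℝ³` enters only through the vanishing face-crossing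
probability `3ρ/s`.
-/

/-- **Stub A1 (shift invariance of box averages of lattice-periodic functions).** For `s > 0`, a bounded
measurable `F : (Fin 3 → ℝ) → ℝ` which is `s`-periodic in each coordinate has
`∫_{[0,s)³} F (u + t) du = ∫_{[0,s)³} F u du` for every `t` (the box is a fundamental domain of `sℤ³`,
and so is its translate; `IsAddFundamentalDomain.setIntegral_eq`). [folklore] -/
theorem stub_boxIntegral_shift :
    ∀ (s : ℝ), 0 < s → ∀ (F : (Fin 3 → ℝ) → ℝ), Measurable F → (∃ M : ℝ, ∀ u, |F u| ≤ M) →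
      (∀ (u : Fin 3 → ℝ) (i : Fin 3), F (u + Pi.single i s) = F u) →
      ∀ t : Fin 3 → ℝ,
        ∫ u in Set.pi Set.univ (fun _ : Fin 3 => Set.Ico (0 : ℝ) s), F (u + t) =
          ∫ u in Set.pi Set.univ (fun _ : Fin 3 => Set.Ico (0 : ℝ) s), F u := by
  exact Summit.AtomisticToContinuum.Crystallization.Theorems.PatternPricedCertificates.stub_boxIntegral_shift

/-- **Stub A2 (box volume and the face-crossing bound).** The box `[0,s)³` has volume `s³`, and for a
point `z` of `ℝ³` the set of offsets `u ∈ [0,s)³` for which `z` and `0` lie in different cubes of the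
partition `sℤ³ + u` (i.e. `⌊(z_i − u_i)/s⌋ ≠ ⌊(0 − u_i)/s⌋` for some `i`) has volume
`≤ s² (|z₀| + |z₁| + |z₂|)` (union bound over the three coordinates; in coordinate `i` the bad
offsets form an interval of length `min(|z_i|, s)`). [folklore] -/
theorem stub_boxIntegral_faceCrossing :
    ∀ (s : ℝ), 0 < s →
      MeasureTheory.volume (Set.pi Set.univ (fun _ : Fin 3 => Set.Ico (0 : ℝ) s)) = ENNReal.ofReal (s ^ 3) ∧
      ∀ z : EuclideanSpace ℝ (Fin 3),
        ∫ u in Set.pi Set.univ (fun _ : Fin 3 => Set.Ico (0 : ℝ) s),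
            (if (∀ i : Fin 3, ⌊(z i - u i) / s⌋ = ⌊(0 - u i) / s⌋) then (0 : ℝ) else 1) ≤
          s ^ 2 * (|z 0| + |z 1| + |z 2|) := by
  exact Summit.AtomisticToContinuum.Crystallization.Theorems.PatternPricedCertificates.stub_boxIntegral_faceCrossing

/-- **Stub B (finite-cluster energy bound with boundary correction).** For `ρ ≥ 1`, a finite set `T`
of points of `ℝ³` and `Y ⊆ T`: `|Y| · e⋆ ≤ Σ_{w ∈ Y} [½ Σ_{z ∈ T∖{w}, ‖z−w‖ ≤ ρ} V_LJ ‖z − w‖ +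
(1/24) #{z ∈ T ∖ Y : ‖z − w‖ ≤ ρ}]`, `e⋆ = ⨅_Q e(Q)`: the pairs inside `Y` carry at least the full
interaction energy of `Y` (the dropped pairs beyond `ρ ≥ 1` have `V_LJ ≤ 0`), which is `≥ |Y| e⋆`
(`card_mul_eStar_le_interactionEnergy`, `bddBelow_energyPerParticle_lennardJones`); each cross pair
costs at most `−min V_LJ = 1/12`, paid by the boundary term. [folklore] -/
theorem stub_clusterEnergyBound :
    ∀ (ρ : ℝ), 1 ≤ ρ → ∀ (T Y : Finset (EuclideanSpace ℝ (Fin 3))), Y ⊆ T →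
      (Y.card : ℝ) * (⨅ Q : Literature.MathematicalPhysics.StatisticalMechanics.PeriodicConfiguration 3,
          Q.energyPerParticle Literature.MathematicalPhysics.StatisticalMechanics.lennardJones) ≤
        ∑ w ∈ Y, ((∑ z ∈ (T.erase w).filter (fun z => ‖z - w‖ ≤ ρ),
            Literature.MathematicalPhysics.StatisticalMechanics.lennardJones ‖z - w‖) / 2 +
          (1 / 24) * ((((T \ Y).filter (fun z => ‖z - w‖ ≤ ρ)).card : ℝ))) := by
  exact Summit.AtomisticToContinuum.Crystallization.Theorems.PatternPricedCertificates.stub_clusterEnergyBound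

/-- **Stub D (the cube transport, pointwise in the offset).** Fix a side `s > 0`, a range `r ≥ 2s`, a
level `L ≥ r + 2s`, an offset `u` and any site functional `χ (pattern, offset)`. For the rule
"`v` receives `χ` (read at `v`, offset seen from `v`) divided by the number of points in the root's cube,
provided `v` lies in the root's cube of the partition `sℤ³ + u`", the level-`(r, L)` transport
(out minus in, the in-term read with the offset `u − v` seen from `v`) of a `(δ, L)`-admissible pattern
equals the cube average of `χ` minus `χ` at the root: both endpoints of a same-cube pair count the same
cube (`same cube ⇒ distance < 2s ≤ r`, and `≤ L − r`, so every cube point is in the lens and in both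
`r`-balls). [folklore] -/
theorem stub_cubeTransport :
    ∀ (s r L δ : ℝ), 0 < s → 2 * s ≤ r → r + 2 * s ≤ L → 0 < δ →
      ∀ (χ : Finset (EuclideanSpace ℝ (Fin 3)) → (Fin 3 → ℝ) → ℝ)
        (G : EuclideanSpace ℝ (Fin 3) → Finset (EuclideanSpace ℝ (Fin 3)) → Finset (EuclideanSpace ℝ (Fin 3)) → (Fin 3 → ℝ) → ℝ),
        (∀ v p q u, G v p q u =
          if (∀ i : Fin 3, ⌊(v i - u i) / s⌋ = ⌊(0 - u i) / s⌋) then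
            χ q (fun i => u i - v i) /
              (((insert (0 : EuclideanSpace ℝ (Fin 3)) p).filter
                (fun w => ∀ i : Fin 3, ⌊(w i - u i) / s⌋ = ⌊(0 - u i) / s⌋)).card : ℝ)
          else 0) →
        ∀ (u : Fin 3 → ℝ) (S : Finset (EuclideanSpace ℝ (Fin 3))),
          Literature.Probability.PointProcesses.IsRootedPattern δ L S →
          ∑ v ∈ Literature.Probability.PointProcesses.lens r L S,
              (G v (Literature.Probability.PointProcesses.ballPattern r S)
                  (Literature.Probability.PointProcesses.ballPattern r (Literature.Probability.PointProcesses.reroot S v)) u -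
                G (-v) (Literature.Probability.PointProcesses.ballPattern r (Literature.Probability.PointProcesses.reroot S v))
                  (Literature.Probability.PointProcesses.ballPattern r S) (fun i => u i - v i)) =
            ((((insert (0 : EuclideanSpace ℝ (Fin 3)) (Literature.Probability.PointProcesses.ballPattern r S)).filter
                (fun w => ∀ i : Fin 3, ⌊(w i - u i) / s⌋ = ⌊(0 - u i) / s⌋)).card : ℝ))⁻¹ *
              ∑ w ∈ (insert (0 : EuclideanSpace ℝ (Fin 3)) (Literature.Probability.PointProcesses.ballPattern r S)).filter
                  (fun w => ∀ i : Fin 3, ⌊(w i - u i) / s⌋ = ⌊(0 - u i) / s⌋),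
                χ (Literature.Probability.PointProcesses.ballPattern r (Literature.Probability.PointProcesses.reroot S w))
                  (fun i => u i - w i) -
            χ (Literature.Probability.PointProcesses.ballPattern r S) u := by
  exact Summit.AtomisticToContinuum.Crystallization.Theorems.PatternPricedCertificates.stub_cubeTransport

/-- **Stub U (unpriced energy bound for point-stationary mean families; "no duality gap at κ = 0"; LANDED by lead c2, `…StubUnpricedMeanBound.lean`).** For every `δ > 0`, every point-stationary mean family on rooted `δ`-separated configurations of `ℝ³` and every radius `ρ ≥ 1`: `⨅_Q e(Q) ≤ ℓ ρ (½ h_ρ)` (the truncated half energies decrease in `ρ ≥ 1` to the energy per particle, which for laws of actual configurations is `≥ e⋆` by `N e⋆ ≤ E(N)`; the content is that point-to-point transport consistency forces the same for pseudo-laws — Følner/allocation). [conjecture] -/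
theorem stub_unpricedMeanBound :
    ∀ δ : ℝ, 0 < δ → ∀ ℓ : ℝ → (Finset (EuclideanSpace ℝ (Fin 3)) → ℝ) → ℝ,
      (∀ (ρ : ℝ) (f₁ f₂ : Finset (EuclideanSpace ℝ (Fin 3)) → ℝ), ℓ ρ (f₁ + f₂) = ℓ ρ f₁ + ℓ ρ f₂) →
      (∀ (ρ t : ℝ) (f : Finset (EuclideanSpace ℝ (Fin 3)) → ℝ), ℓ ρ (t • f) = t * ℓ ρ f) →
      (∀ (ρ : ℝ) (f : Finset (EuclideanSpace ℝ (Fin 3)) → ℝ), (∀ S : Finset (EuclideanSpace ℝ (Fin 3)), Literature.Probability.PointProcesses.IsRootedPattern δ ρ S → 0 ≤ f S ∧ f S ≤ 1) → 0 ≤ ℓ ρ f) →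
      (∀ ρ : ℝ, ℓ ρ (fun _ => 1) = 1) →
      (∀ ρ ρ' : ℝ, ρ ≤ ρ' → ∀ f : Finset (EuclideanSpace ℝ (Fin 3)) → ℝ, ℓ ρ' (fun S => f (Literature.Probability.PointProcesses.ballPattern ρ S)) = ℓ ρ f) →
      (∀ r ρ : ℝ, 0 ≤ r → ∀ g : EuclideanSpace ℝ (Fin 3) → Finset (EuclideanSpace ℝ (Fin 3)) → Finset (EuclideanSpace ℝ (Fin 3)) → ℝ, (∃ M : ℝ, ∀ v p q, |g v p q| ≤ M) →
        ℓ ρ (fun S => ∑ v ∈ Literature.Probability.PointProcesses.lens r ρ S, (g v (Literature.Probability.PointProcesses.ballPattern r S) (Literature.Probability.PointProcesses.ballPattern r (Literature.Probability.PointProcesses.reroot S v)) - g (-v) (Literature.Probability.PointProcesses.ballPattern r (Literature.Probability.PointProcesses.reroot S v)) (Literature.Probability.PointProcesses.ballPattern r S))) = 0) →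
      ∀ ρ : ℝ, 1 ≤ ρ → (⨅ Q : Literature.MathematicalPhysics.StatisticalMechanics.PeriodicConfiguration 3, Q.energyPerParticle Literature.MathematicalPhysics.StatisticalMechanics.lennardJones) ≤
        ℓ ρ (fun S => (∑ v ∈ S, Literature.MathematicalPhysics.StatisticalMechanics.lennardJones ‖v‖) / 2) := by
  exact Summit.AtomisticToContinuum.Crystallization.Theorems.PatternPricedCertificates.stub_unpricedMeanBound

/-- Statement of `stub_qualitativeMeansRigidity` (verbatim). [conjecture] -/
def Sig.stub_qualitativeMeansRigidity : Prop :=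
    ∃ P : Literature.MathematicalPhysics.StatisticalMechanics.PeriodicConfiguration 3, ∀ δ : ℝ, 0 < δ → ∀ ℓ : ℝ → (Finset (EuclideanSpace ℝ (Fin 3)) → ℝ) → ℝ,
      (∀ (ρ : ℝ) (f₁ f₂ : Finset (EuclideanSpace ℝ (Fin 3)) → ℝ), ℓ ρ (f₁ + f₂) = ℓ ρ f₁ + ℓ ρ f₂) →
      (∀ (ρ t : ℝ) (f : Finset (EuclideanSpace ℝ (Fin 3)) → ℝ), ℓ ρ (t • f) = t * ℓ ρ f) →
      (∀ (ρ : ℝ) (f : Finset (EuclideanSpace ℝ (Fin 3)) → ℝ), (∀ S : Finset (EuclideanSpace ℝ (Fin 3)), Literature.Probability.PointProcesses.IsRootedPattern δ ρ S → 0 ≤ f S ∧ f S ≤ 1) → 0 ≤ ℓ ρ f) →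
      (∀ ρ : ℝ, ℓ ρ (fun _ => 1) = 1) →
      (∀ ρ ρ' : ℝ, ρ ≤ ρ' → ∀ f : Finset (EuclideanSpace ℝ (Fin 3)) → ℝ, ℓ ρ' (fun S => f (Literature.Probability.PointProcesses.ballPattern ρ S)) = ℓ ρ f) →
      (∀ r ρ : ℝ, 0 ≤ r → ∀ g : EuclideanSpace ℝ (Fin 3) → Finset (EuclideanSpace ℝ (Fin 3)) → Finset (EuclideanSpace ℝ (Fin 3)) → ℝ, (∃ M : ℝ, ∀ v p q, |g v p q| ≤ M) →
        ℓ ρ (fun S => ∑ v ∈ Literature.Probability.PointProcesses.lens r ρ S, (g v (Literature.Probability.PointProcesses.ballPattern r S) (Literature.Probability.PointProcesses.ballPattern r (Literature.Probability.PointProcesses.reroot S v)) - g (-v) (Literature.Probability.PointProcesses.ballPattern r (Literature.Probability.PointProcesses.reroot S v)) (Literature.Probability.PointProcesses.ballPattern r S))) = 0) →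
      (∀ η : ℝ, 0 < η → ∃ ρ : ℝ, 1 ≤ ρ ∧ ℓ ρ (fun S => (∑ v ∈ S, Literature.MathematicalPhysics.StatisticalMechanics.lennardJones ‖v‖) / 2) ≤ (⨅ Q : Literature.MathematicalPhysics.StatisticalMechanics.PeriodicConfiguration 3, Q.energyPerParticle Literature.MathematicalPhysics.StatisticalMechanics.lennardJones) + η) →
      ∀ R ε : ℝ, 0 < R → 0 < ε →
        ℓ (R + ε) (fun S => (if (∃ A : EuclideanSpace ℝ (Fin 3) →ₗᵢ[ℝ] EuclideanSpace ℝ (Fin 3), (∀ p ∈ P.points, ‖p‖ ≤ R → ∃ v ∈ insert (0 : EuclideanSpace ℝ (Fin 3)) S, dist v (A p) ≤ ε) ∧ (∀ v ∈ insert (0 : EuclideanSpace ℝ (Fin 3)) S, ‖v‖ ≤ R → ∃ p ∈ P.points, dist v (A p) ≤ ε)) then (0 : ℝ) else 1)) = 0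

/-- Statement of `stub_unpricedMeanBound` (verbatim). [conjecture] -/
def Sig.stub_unpricedMeanBound : Prop :=
    ∀ δ : ℝ, 0 < δ → ∀ ℓ : ℝ → (Finset (EuclideanSpace ℝ (Fin 3)) → ℝ) → ℝ,
      (∀ (ρ : ℝ) (f₁ f₂ : Finset (EuclideanSpace ℝ (Fin 3)) → ℝ), ℓ ρ (f₁ + f₂) = ℓ ρ f₁ + ℓ ρ f₂) →
      (∀ (ρ t : ℝ) (f : Finset (EuclideanSpace ℝ (Fin 3)) → ℝ), ℓ ρ (t • f) = t * ℓ ρ f) →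
      (∀ (ρ : ℝ) (f : Finset (EuclideanSpace ℝ (Fin 3)) → ℝ), (∀ S : Finset (EuclideanSpace ℝ (Fin 3)), Literature.Probability.PointProcesses.IsRootedPattern δ ρ S → 0 ≤ f S ∧ f S ≤ 1) → 0 ≤ ℓ ρ f) →
      (∀ ρ : ℝ, ℓ ρ (fun _ => 1) = 1) →
      (∀ ρ ρ' : ℝ, ρ ≤ ρ' → ∀ f : Finset (EuclideanSpace ℝ (Fin 3)) → ℝ, ℓ ρ' (fun S => f (Literature.Probability.PointProcesses.ballPattern ρ S)) = ℓ ρ f) →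
      (∀ r ρ : ℝ, 0 ≤ r → ∀ g : EuclideanSpace ℝ (Fin 3) → Finset (EuclideanSpace ℝ (Fin 3)) → Finset (EuclideanSpace ℝ (Fin 3)) → ℝ, (∃ M : ℝ, ∀ v p q, |g v p q| ≤ M) →
        ℓ ρ (fun S => ∑ v ∈ Literature.Probability.PointProcesses.lens r ρ S, (g v (Literature.Probability.PointProcesses.ballPattern r S) (Literature.Probability.PointProcesses.ballPattern r (Literature.Probability.PointProcesses.reroot S v)) - g (-v) (Literature.Probability.PointProcesses.ballPattern r (Literature.Probability.PointProcesses.reroot S v)) (Literature.Probability.PointProcesses.ballPattern r S))) = 0) →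
      ∀ ρ : ℝ, 1 ≤ ρ → (⨅ Q : Literature.MathematicalPhysics.StatisticalMechanics.PeriodicConfiguration 3, Q.energyPerParticle Literature.MathematicalPhysics.StatisticalMechanics.lennardJones) ≤
        ℓ ρ (fun S => (∑ v ∈ S, Literature.MathematicalPhysics.StatisticalMechanics.lennardJones ‖v‖) / 2)

/-- **The unpriced bound holds** (stub U, LANDED p162467 by lead c2). [folklore] -/
theorem unpricedMeanBound_holds : Sig.stub_unpricedMeanBound :=
  Summit.AtomisticToContinuum.Crystallization.Theorems.PatternPricedCertificates.stub_unpricedMeanBound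

/-- A Banach-type limit vanishes on the null sequence `1/(n+2)`. [folklore] -/
theorem banachLimit_inv_add_two {Λ : (ℕ → ℝ) → ℝ}
    (hadd : ∀ a b : ℕ → ℝ, Λ (a + b) = Λ a + Λ b) (hsmul : ∀ (t : ℝ) (a : ℕ → ℝ), Λ (t • a) = t * Λ a)
    (hpos : ∀ a : ℕ → ℝ, (∀ n, 0 ≤ a n ∧ a n ≤ 1) → 0 ≤ Λ a) (hone : Λ (fun _ => 1) = 1)
    (hzero : ∀ a : ℕ → ℝ, (∃ n₀ : ℕ, ∀ n, n₀ ≤ n → a n = 0) → Λ a = 0) :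
    Λ (fun n : ℕ => 1 / ((n : ℝ) + 2)) = 0 := by
  have hpos' : ∀ a : ℕ → ℝ, (∀ n, True → 0 ≤ a n ∧ a n ≤ 1) → 0 ≤ Λ a :=
    fun a ha => hpos a fun n => ha n trivial
  have hκ01 : ∀ n : ℕ, 0 ≤ 1 / ((n : ℝ) + 2) ∧ 1 / ((n : ℝ) + 2) ≤ 1 := fun n => by
    have hn : (0 : ℝ) ≤ n := Nat.cast_nonneg n
    constructor
    · positivity
    · rw [div_le_one (by linarith)]; linarith
  have h0 : 0 ≤ Λ (fun n : ℕ => 1 / ((n : ℝ) + 2)) := hpos _ hκ01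
  refine le_antisymm ?_ h0
  by_contra hc
  push Not at hc
  set L := Λ (fun n : ℕ => 1 / ((n : ℝ) + 2)) with hL
  -- split at `N` with `1/(N+2) ≤ L/2`
  obtain ⟨N, hN⟩ := exists_nat_one_div_lt (half_pos hc)
  set tail : ℕ → ℝ := fun n => if N ≤ n then 1 / ((n : ℝ) + 2) else 0 with htail
  set head : ℕ → ℝ := fun n => if N ≤ n then 0 else 1 / ((n : ℝ) + 2) with hhead
  have hsplit : (fun n : ℕ => 1 / ((n : ℝ) + 2)) = head + tail := by
    funext n; simp only [hhead, htail, Pi.add_apply]; split_ifs <;> simp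
  have hhead0 : Λ head = 0 := hzero head ⟨N, fun n hn => by simp [hhead, hn]⟩
  have htail_le : Λ tail ≤ L / 2 := by
    have h := levelLift_mean_mem_Icc (Ω := fun _ => True) hadd hsmul hpos' hone (f := tail)
      (lo := 0) (hi := L / 2) (half_pos hc) (fun n _ => ?_)
    · exact h.2
    simp only [htail]
    split_ifs with hn
    · refine ⟨by positivity, ?_⟩
      have h1 : 1 / ((n : ℝ) + 2) ≤ 1 / ((N : ℝ) + 1) := by
        apply one_div_le_one_div_of_le (by positivity)
        have : (N : ℝ) ≤ n := by exact_mod_cast hn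
        linarith
      linarith
    · exact ⟨le_rfl, (half_pos hc).le⟩
  have : L = Λ head + Λ tail := by rw [hL, hsplit, hadd]
  linarith

/-- A subset of an admissible pattern is admissible. [folklore] -/
theorem isRootedPattern_filter {δ L : ℝ} {S : Finset (EuclideanSpace ℝ (Fin 3))}
    (hS : IsRootedPattern δ L S) (p : EuclideanSpace ℝ (Fin 3) → Prop) [DecidablePred p] :
    IsRootedPattern δ L (S.filter p) :=
  ⟨fun v hv => hS.1 v (Finset.mem_filter.1 hv).1,
    fun v hv w hw hvw => hS.2 v (Finset.mem_filter.1 hv).1 w (Finset.mem_filter.1 hw).1 hvw⟩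

/-- **The priced core from the qualitative core and the unpriced bound** (compactness = Banach limit
of the violating families at prices `κ_n = 1/(n+2) → 0`). [folklore] -/
theorem stationaryMeansRigidity_of (hQ : Sig.stub_qualitativeMeansRigidity)
    (hU : Sig.stub_unpricedMeanBound) : Sig.stub_stationaryMeansRigidity := by
  obtain ⟨P, hP⟩ := hQ
  refine ⟨P, fun δ R ε θ hδ hR hε hθ => ?_⟩
  by_contra hcon
  push Not at hcon
  -- near-optimal periodic `Q_n`, prices `κ_n = 1/(n+2)`, constants `c_n = e(Q_n) − κ_n θ`
  set estar : ℝ := (⨅ Q : PeriodicConfiguration 3, Q.energyPerParticle lennardJones) with hestar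
  have hB := Summit.AtomisticToContinuum.Crystallization.Theorems.ChargedEnergyGapNegative.bddBelow_energyPerParticle_lennardJones
  set κ : ℕ → ℝ := fun n => 1 / ((n : ℝ) + 2) with hκdef
  have hκ0 : ∀ n, 0 < κ n := fun n => by simp only [hκdef]; positivity
  have hκ1 : ∀ n, κ n ≤ 1 := fun n => by
    simp only [hκdef]
    rw [div_le_one (by positivity)]
    linarith [(Nat.cast_nonneg n : (0 : ℝ) ≤ n)]
  have hQn : ∀ n : ℕ, ∃ Q : PeriodicConfiguration 3,
      Q.energyPerParticle lennardJones < estar + κ n * θ / 2 := fun n =>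
    exists_lt_of_ciInf_lt (by have := hκ0 n; simp only [hestar]; nlinarith)
  choose Qn hQn using hQn
  choose ℓ h1 h2 h3 h4 h5 h6 ρn hρn1 hρn2 hviol using fun n : ℕ =>
    hcon (κ n) ((Qn n).energyPerParticle lennardJones - κ n * θ) (Qn n) (hκ0 n) (hκ1 n) (by linarith)
  -- defect masses `b_n` and their lower bound `θ/2`
  set badf : Finset (EuclideanSpace ℝ (Fin 3)) → ℝ := fun S => (if (∃ A : EuclideanSpace ℝ (Fin 3) →ₗᵢ[ℝ] EuclideanSpace ℝ (Fin 3), (∀ p ∈ P.points, ‖p‖ ≤ R → ∃ v ∈ insert (0 : EuclideanSpace ℝ (Fin 3)) S, dist v (A p) ≤ ε) ∧ (∀ v ∈ insert (0 : EuclideanSpace ℝ (Fin 3)) S, ‖v‖ ≤ R → ∃ p ∈ P.points, dist v (A p) ≤ ε)) then (0 : ℝ) else 1) with hbadf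
  set halff : Finset (EuclideanSpace ℝ (Fin 3)) → ℝ := fun S => (∑ v ∈ S, Literature.MathematicalPhysics.StatisticalMechanics.lennardJones ‖v‖) / 2 with hhalff
  have hbad_cyl : (fun S => badf (ballPattern (R + ε) S)) = badf := by
    funext S
    simp only [hbadf]
    rw [levelLift_good_ballPattern_iff P hε.le le_rfl S]
  set b : ℕ → ℝ := fun n => ℓ n (R + ε) badf with hb
  have hbρ : ∀ n, ℓ n (ρn n) badf = b n := fun n => by
    have h := h5 n (R + ε) (ρn n) (hρn1 n) badf
    rw [hbad_cyl] at h
    exact h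
  have hb01 : ∀ n, 0 ≤ b n ∧ b n ≤ 1 := fun n =>
    levelLift_mean_mem_Icc (Ω := fun S => IsRootedPattern δ (R + ε) S) (h1 n (R + ε)) (h2 n (R + ε))
      (h3 n (R + ε)) (h4 n (R + ε)) zero_lt_one (fun S _ => by
        simp only [hbadf]; split_ifs <;> norm_num)
  have hbθ : ∀ n, θ / 2 < b n := fun n => by
    have hUn := hU δ hδ (ℓ n) (h1 n) (h2 n) (h3 n) (h4 n) (h5 n) (h6 n) (ρn n) (hρn2 n)
    have hv := hviol n
    rw [hbρ n] at hv
    have hq := hQn n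
    -- κ_n b_n > e⋆ − c_n ≥ κ_n θ / 2
    have hkb : κ n * (θ / 2) < κ n * b n := by
      simp only [hestar] at hq hUn
      nlinarith
    exact lt_of_mul_lt_mul_left hkb (hκ0 n).le
  -- energies at every radius `ρ ≥ 1`: `ℓ_n ρ (½h) ≤ e⋆ + κ_n (1 + θ/2) + η/2` once `ρ ≥ ρfar(η)`
  have henergy : ∀ η : ℝ, 0 < η → ∃ ρ : ℝ, 1 ≤ ρ ∧ ∀ n,
      ℓ n ρ halff ≤ estar + κ n * (1 + θ / 2) + η / 2 := by
    intro η hη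
    obtain ⟨ρfar, hfar⟩ := Summit.AtomisticToContinuum.Crystallization.Theorems.PatternPricedCertificates.stub_patternFarField δ hδ η hη
    refine ⟨max 1 ρfar, le_max_left _ _, fun n => ?_⟩
    set ρ := max 1 ρfar with hρdef
    have hρ1 : 1 ≤ ρ := le_max_left _ _
    have hρfar : ρfar ≤ ρ := le_max_right _ _
    -- the violation at radius ρ_n, and c_n + κ_n b_n ≤ e⋆ + κ_n (1 + θ/2)
    have hv := hviol n
    rw [hbρ n] at hv
    have hq := hQn n
    have hcn : (Qn n).energyPerParticle lennardJones - κ n * θ + κ n * b n ≤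
        estar + κ n * (1 + θ / 2) := by
      have := (hb01 n).2
      have hk := hκ0 n
      nlinarith
    rcases le_or_gt ρ (ρn n) with hle | hgt
    · -- ρ ≤ ρ_n: ℓ_n ρ (½h) = ℓ_n ρ_n (½h ∘ B_ρ) ≤ ℓ_n ρ_n (½h) + η/2
      have hproj := h5 n ρ (ρn n) hle halff
      have hmono : ℓ n (ρn n) (fun S => halff (ballPattern ρ S)) ≤
          ℓ n (ρn n) (fun S => halff S + η / 2) := by
        refine levelLift_mean_mono (Ω := fun S => IsRootedPattern δ (ρn n) S) (h1 n _) (h2 n _)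
          (h3 n _) (M := η) hη (fun S hS => ?_) (fun S hS => ?_)
        · have hf := hfar ρ (ρn n) hρfar S hS
          have hsplit := Finset.sum_filter_add_sum_filter_not S (fun v => ‖v‖ ≤ ρ)
            (fun v => lennardJones ‖v‖)
          have hball : ∑ v ∈ ballPattern ρ S, lennardJones ‖v‖ =
              ∑ v ∈ S.filter (fun v => ‖v‖ ≤ ρ), lennardJones ‖v‖ := rfl
          simp only [hhalff]
          rw [hball]
          linarith
        · have hsplit := Finset.sum_filter_add_sum_filter_not S (fun v => ‖v‖ ≤ ρ)
            (fun v => lennardJones ‖v‖)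
          have hball : ∑ v ∈ ballPattern ρ S, lennardJones ‖v‖ =
              ∑ v ∈ S.filter (fun v => ‖v‖ ≤ ρ), lennardJones ‖v‖ := rfl
          have hfar0 : ∑ v ∈ S.filter (fun v => ¬ ‖v‖ ≤ ρ), lennardJones ‖v‖ ≤ 0 := by
            refine Finset.sum_nonpos fun v hv => ?_
            simp only [Finset.mem_filter, not_le] at hv
            exact Literature.MathematicalPhysics.StatisticalMechanics.lennardJones_nonpos (by linarith [hv.2])
          simp only [hhalff]
          rw [hball]
          linarith
      have hconst : ℓ n (ρn n) (fun S => halff S + η / 2) = ℓ n (ρn n) halff + η / 2 := by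
        have h : (fun S : Finset (EuclideanSpace ℝ (Fin 3)) => halff S + η / 2) =
            halff + (fun _ => η / 2) := by
          funext S; simp only [Pi.add_apply]
        rw [h, h1 n, levelLift_mean_const (h2 n _) (h4 n _)]
      rw [← hproj]
      linarith
    · -- ρ_n < ρ: ℓ_n ρ (½h) ≤ ℓ_n ρ (½h ∘ B_{ρ_n}) = ℓ_n ρ_n (½h)
      have hproj := h5 n (ρn n) ρ hgt.le halff
      obtain ⟨Mρ, hMρ⟩ := levelLift_abs_sum_le hδ ρ
      have hmono : ℓ n ρ halff ≤ ℓ n ρ (fun S => halff (ballPattern (ρn n) S)) := by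
        refine levelLift_mean_mono (Ω := fun S => IsRootedPattern δ ρ S) (h1 n _) (h2 n _)
          (h3 n _) (M := Mρ + 1) (by linarith [(abs_nonneg _).trans (hMρ ∅ (Literature.Probability.PointProcesses.isRootedPattern_empty δ ρ))])
          (fun S hS => ?_) (fun S hS => ?_)
        · have hsplit := Finset.sum_filter_add_sum_filter_not S (fun v => ‖v‖ ≤ ρn n)
            (fun v => lennardJones ‖v‖)
          have hball : ∑ v ∈ ballPattern (ρn n) S, lennardJones ‖v‖ =
              ∑ v ∈ S.filter (fun v => ‖v‖ ≤ ρn n), lennardJones ‖v‖ := rfl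
          have hfar0 : ∑ v ∈ S.filter (fun v => ¬ ‖v‖ ≤ ρn n), lennardJones ‖v‖ ≤ 0 := by
            refine Finset.sum_nonpos fun v hv => ?_
            simp only [Finset.mem_filter, not_le] at hv
            exact Literature.MathematicalPhysics.StatisticalMechanics.lennardJones_nonpos (by linarith [hv.2, hρn2 n])
          simp only [hhalff]
          rw [hball]
          linarith
        · have hA := hMρ S hS
          have hB' := hMρ _ (isRootedPattern_filter hS (fun v => ‖v‖ ≤ ρn n))
          have hball : ∑ v ∈ ballPattern (ρn n) S, lennardJones ‖v‖ =
              ∑ v ∈ S.filter (fun v => ‖v‖ ≤ ρn n), lennardJones ‖v‖ := rfl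
          simp only [hhalff]
          rw [hball]
          rw [abs_le] at hA hB'
          linarith [hA.1, hB'.2]
      rw [hproj] at hmono
      linarith
  -- the Banach limit of the violating families
  obtain ⟨Λ, hΛadd, hΛsmul, hΛpos, hΛone, hΛzero⟩ := Summit.AtomisticToContinuum.Crystallization.Theorems.PatternPricedCertificates.stub_banachLimit
  have hΛpos' : ∀ a : ℕ → ℝ, (∀ n, True → 0 ≤ a n ∧ a n ≤ 1) → 0 ≤ Λ a :=
    fun a ha => hΛpos a fun n => ha n trivial
  set ℓ₀ : ℝ → (Finset (EuclideanSpace ℝ (Fin 3)) → ℝ) → ℝ := fun ρ f => Λ (fun n => ℓ n ρ f) with hℓ₀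
  have G1 : ∀ (ρ : ℝ) (f₁ f₂ : Finset (EuclideanSpace ℝ (Fin 3)) → ℝ),
      ℓ₀ ρ (f₁ + f₂) = ℓ₀ ρ f₁ + ℓ₀ ρ f₂ := by
    intro ρ f₁ f₂
    simp only [hℓ₀]
    rw [← hΛadd]
    congr 1
    funext n
    exact h1 n ρ f₁ f₂
  have G2 : ∀ (ρ t : ℝ) (f : Finset (EuclideanSpace ℝ (Fin 3)) → ℝ), ℓ₀ ρ (t • f) = t * ℓ₀ ρ f := by
    intro ρ t f
    simp only [hℓ₀]
    rw [← hΛsmul]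
    congr 1
    funext n
    exact h2 n ρ t f
  have G3 : ∀ (ρ : ℝ) (f : Finset (EuclideanSpace ℝ (Fin 3)) → ℝ),
      (∀ S : Finset (EuclideanSpace ℝ (Fin 3)), IsRootedPattern δ ρ S → 0 ≤ f S ∧ f S ≤ 1) →
      0 ≤ ℓ₀ ρ f := by
    intro ρ f hf
    simp only [hℓ₀]
    refine hΛpos _ fun n => ?_
    exact levelLift_mean_mem_Icc (Ω := fun S => IsRootedPattern δ ρ S)
      (h1 n ρ) (h2 n ρ) (h3 n ρ) (h4 n ρ) zero_lt_one hf
  have G4 : ∀ ρ : ℝ, ℓ₀ ρ (fun _ => 1) = 1 := by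
    intro ρ
    simp only [hℓ₀]
    have h : (fun n => ℓ n ρ (fun _ => (1 : ℝ))) = fun _ => 1 := funext fun n => h4 n ρ
    rw [h, hΛone]
  have G5 : ∀ ρ ρ' : ℝ, ρ ≤ ρ' → ∀ f : Finset (EuclideanSpace ℝ (Fin 3)) → ℝ,
      ℓ₀ ρ' (fun S => f (ballPattern ρ S)) = ℓ₀ ρ f := by
    intro ρ ρ' hρρ' f
    simp only [hℓ₀]
    congr 1
    funext n
    exact h5 n ρ ρ' hρρ' f
  have G6 : ∀ r ρ : ℝ, 0 ≤ r →
      ∀ g : EuclideanSpace ℝ (Fin 3) → Finset (EuclideanSpace ℝ (Fin 3)) → Finset (EuclideanSpace ℝ (Fin 3)) → ℝ, (∃ M : ℝ, ∀ v p q, |g v p q| ≤ M) →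
        ℓ₀ ρ (fun S => ∑ v ∈ Literature.Probability.PointProcesses.lens r ρ S, (g v (Literature.Probability.PointProcesses.ballPattern r S) (Literature.Probability.PointProcesses.ballPattern r (Literature.Probability.PointProcesses.reroot S v)) - g (-v) (Literature.Probability.PointProcesses.ballPattern r (Literature.Probability.PointProcesses.reroot S v)) (Literature.Probability.PointProcesses.ballPattern r S))) = 0 := by
    intro r ρ hr g hg
    simp only [hℓ₀]
    refine hΛzero _ ⟨0, fun n _ => ?_⟩
    exact h6 n r ρ hr g hg
  -- `ℓ₀` has minimal energy
  have hmin : ∀ η : ℝ, 0 < η → ∃ ρ : ℝ, 1 ≤ ρ ∧ ℓ₀ ρ halff ≤ estar + η := by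
    intro η hη
    obtain ⟨ρ, hρ1, hρ⟩ := henergy η hη
    refine ⟨ρ, hρ1, ?_⟩
    simp only [hℓ₀]
    obtain ⟨Mρ, hMρ⟩ := levelLift_abs_sum_le hδ ρ
    have hsbd : ∀ n, -(Mρ / 2 + 1) ≤ ℓ n ρ halff ∧ ℓ n ρ halff ≤ Mρ / 2 + 1 := fun n => by
      refine levelLift_mean_mem_Icc (Ω := fun S => IsRootedPattern δ ρ S)
        (h1 n ρ) (h2 n ρ) (h3 n ρ) (h4 n ρ) (by linarith [(abs_nonneg _).trans (hMρ ∅ (Literature.Probability.PointProcesses.isRootedPattern_empty δ ρ))]) (fun S hS => ?_)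
      have h := hMρ S hS
      rw [abs_le] at h
      simp only [hhalff]
      constructor <;> linarith [h.1, h.2]
    have hmono : Λ (fun n => ℓ n ρ halff) ≤ Λ (fun n => estar + η / 2 + (1 + θ / 2) * κ n) := by
      refine levelLift_mean_mono (Ω := fun _ => True) hΛadd hΛsmul hΛpos'
        (M := |estar| + η / 2 + (1 + θ / 2) + (Mρ / 2 + 1) + 1)
        (by linarith [abs_nonneg estar, (abs_nonneg _).trans (hMρ ∅ (Literature.Probability.PointProcesses.isRootedPattern_empty δ ρ))])
        (fun n _ => by linarith [hρ n]) (fun n _ => ?_)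
      have hk := hκ1 n
      have hk0 := (hκ0 n).le
      have : (1 + θ / 2) * κ n ≤ (1 + θ / 2) := by nlinarith
      linarith [le_abs_self estar, (hsbd n).1]
    have hlin : Λ (fun n => estar + η / 2 + (1 + θ / 2) * κ n) = estar + η / 2 := by
      have h : (fun n => estar + η / 2 + (1 + θ / 2) * κ n) =
          (fun _ => estar + η / 2) + (1 + θ / 2) • κ := by
        funext n; simp only [Pi.add_apply, Pi.smul_apply, smul_eq_mul]
      rw [h, hΛadd, hΛsmul, levelLift_mean_const hΛsmul hΛone,
        banachLimit_inv_add_two hΛadd hΛsmul hΛpos hΛone hΛzero, mul_zero, add_zero]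
    linarith
  -- the qualitative core kills the defect mass of `ℓ₀`, but it is `≥ θ/2`
  have hzero := hP δ hδ ℓ₀ G1 G2 G3 G4 G5 G6 hmin R ε hR hε
  have hpos : θ / 2 ≤ ℓ₀ (R + ε) badf := by
    simp only [hℓ₀]
    have h := levelLift_mean_mono (Ω := fun _ => True) hΛadd hΛsmul hΛpos'
      (f := fun _ => θ / 2) (g := fun n => ℓ n (R + ε) badf) (M := 1) one_pos
      (fun n _ => (hbθ n).le) (fun n _ => by linarith [(hb01 n).2, hθ])
    rwa [levelLift_mean_const hΛsmul hΛone] at h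
  simp only [hℓ₀, hbadf] at hzero hpos
  linarith

end ReshapeV6

/-- The priced core (birth-v2 stub `stub_stationaryMeansRigidity`), now DERIVED from stubs Q and U by
`stationaryMeansRigidity_of`. [conjecture] -/
theorem stationaryMeansRigidity_derived (hQ : Sig.stub_qualitativeMeansRigidity) : Sig.stub_stationaryMeansRigidity :=
  stationaryMeansRigidity_of hQ unpricedMeanBound_holds

/-! ## Composition (layer 2, lead): primal core + level lift + duality ⟹ the dual certificate -/

section Composition

open Literature.Probability.PointProcesses (IsRootedPattern ballPattern lens reroot)
open Literature.MathematicalPhysics.StatisticalMechanics (lennardJones)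

/-- **The dual finite-level certificate from the primal core.** `Sig.stub_stationaryMeansRigidity →
Sig.stub_levelLift → Sig.stub_meanDuality → Sig.stub_patternCertificates`: take `P, κ, c, Q` from the core at
budget `θ/2`; the level lift with `η = κθ/4` gives a level `(r, L)` beyond `L₀` at which every
lens-consistent mean satisfies `c − κθ/4 + κ m(bad) ≤ m(½h_L)`, i.e. is non-negative on
`a := ½h_L − κ·bad − (c − κθ/4)` (bounded on admissible patterns by `abs_sum_lennardJones_le`); duality
with `η = κθ/4` gives a bounded rule `g` with `(c − κθ/2) + κ·bad ≤ ½h_L + T_g` pointwise, and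
`e(Q) ≤ c + κθ/2 = (c − κθ/2) + κθ`. [folklore] -/
theorem dualCertificates_of (hA : Sig.stub_stationaryMeansRigidity) (hB : Sig.stub_levelLift)
    (hC : Sig.stub_meanDuality) : Sig.stub_patternCertificates := by
  obtain ⟨P, hP⟩ := hA
  refine ⟨P, fun δ R ε θ hδ hR hε hθ => ?_⟩
  obtain ⟨κ, c, Q, hκ0, hκ1, hQ, hprim⟩ := hP δ R ε (θ / 2) hδ hR hε (half_pos hθ)
  refine ⟨κ, hκ0, hκ1, fun L₀ => ?_⟩
  have hη : 0 < κ * θ / 4 := by positivity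
  obtain ⟨L, r, hL₀L, hRL, hr0, hrL, hfin⟩ := hB P δ R ε κ c hδ hR hε hprim (κ * θ / 4) hη L₀
  set bad : Finset (EuclideanSpace ℝ (Fin 3)) → ℝ := fun S => (if (∃ A : EuclideanSpace ℝ (Fin 3) →ₗᵢ[ℝ] EuclideanSpace ℝ (Fin 3), (∀ p ∈ P.points, ‖p‖ ≤ R → ∃ v ∈ insert (0 : EuclideanSpace ℝ (Fin 3)) S, dist v (A p) ≤ ε) ∧ (∀ v ∈ insert (0 : EuclideanSpace ℝ (Fin 3)) S, ‖v‖ ≤ R → ∃ p ∈ P.points, dist v (A p) ≤ ε)) then (0 : ℝ) else 1) with hbad_def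
  set half : Finset (EuclideanSpace ℝ (Fin 3)) → ℝ := fun S => (∑ v ∈ S, Literature.MathematicalPhysics.StatisticalMechanics.lennardJones ‖v‖) / 2 with hhalf_def
  set a : Finset (EuclideanSpace ℝ (Fin 3)) → ℝ := fun S => half S - κ * bad S - (c - κ * θ / 4) with ha_def
  obtain ⟨M, hM⟩ := Summit.AtomisticToContinuum.Crystallization.Theorems.PatternPricedCertificates.levelLift_abs_sum_le hδ L
  have hbad1 : ∀ S, |bad S| ≤ 1 := fun S => by
    simp only [hbad_def]
    split_ifs <;> simp
  have ha_bdd : ∃ M' : ℝ, ∀ S : Finset (EuclideanSpace ℝ (Fin 3)), IsRootedPattern δ L S → |a S| ≤ M' := by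
    refine ⟨M / 2 + |κ| + |c - κ * θ / 4|, fun S hS => ?_⟩
    have h1 : |half S| ≤ M / 2 := by
      have : |half S| = |∑ v ∈ S, lennardJones ‖v‖| / 2 := by
        simp only [hhalf_def, abs_div, abs_two]
      rw [this]
      linarith [hM S hS]
    have h2 : |κ * bad S| ≤ |κ| := by
      rw [abs_mul]
      exact mul_le_of_le_one_right (abs_nonneg κ) (hbad1 S)
    calc |a S| = |half S - κ * bad S - (c - κ * θ / 4)| := rfl
      _ ≤ |half S - κ * bad S| + |c - κ * θ / 4| := abs_sub _ _
      _ ≤ |half S| + |κ * bad S| + |c - κ * θ / 4| := by gcongr; exact abs_sub _ _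
      _ ≤ M / 2 + |κ| + |c - κ * θ / 4| := by gcongr
  have hyp : ∀ m : (Finset (EuclideanSpace ℝ (Fin 3)) → ℝ) → ℝ,
      (∀ f₁ f₂ : Finset (EuclideanSpace ℝ (Fin 3)) → ℝ, m (f₁ + f₂) = m f₁ + m f₂) →
      (∀ (t : ℝ) (f : Finset (EuclideanSpace ℝ (Fin 3)) → ℝ), m (t • f) = t * m f) →
      (∀ f : Finset (EuclideanSpace ℝ (Fin 3)) → ℝ, (∀ S : Finset (EuclideanSpace ℝ (Fin 3)), IsRootedPattern δ L S → 0 ≤ f S ∧ f S ≤ 1) → 0 ≤ m f) →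
      m (fun _ => 1) = 1 →
      (∀ g : EuclideanSpace ℝ (Fin 3) → Finset (EuclideanSpace ℝ (Fin 3)) → Finset (EuclideanSpace ℝ (Fin 3)) → ℝ, (∃ M : ℝ, ∀ v p q, |g v p q| ≤ M) →
        m (fun S => ∑ v ∈ Literature.Probability.PointProcesses.lens r L S, (g v (Literature.Probability.PointProcesses.ballPattern r S) (Literature.Probability.PointProcesses.ballPattern r (Literature.Probability.PointProcesses.reroot S v)) - g (-v) (Literature.Probability.PointProcesses.ballPattern r (Literature.Probability.PointProcesses.reroot S v)) (Literature.Probability.PointProcesses.ballPattern r S))) = 0) →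
      0 ≤ m a := by
    intro m hadd hsmul hpos hone hcons
    have h := hfin m hadd hsmul hpos hone hcons
    have ha : a = half + ((-κ) • bad + (fun _ => -(c - κ * θ / 4))) := by
      ext S
      simp only [ha_def, Pi.add_apply, Pi.smul_apply, smul_eq_mul]
      ring
    rw [ha, hadd, hadd, hsmul,
      Summit.AtomisticToContinuum.Crystallization.Theorems.PatternPricedCertificates.levelLift_mean_const hsmul hone]
    linarith
  obtain ⟨g, hg, hcert⟩ := hC δ r L hδ a ha_bdd hyp (κ * θ / 4) hη
  refine ⟨L, r, c - κ * θ / 2, g, Q, hL₀L, hRL, hr0, hrL, by linarith, fun S hS => ?_⟩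
  have h := hcert S hS
  simp only [ha_def, hhalf_def, hbad_def] at h
  split_ifs at h with hgood
  · rw [if_pos hgood]
    linarith
  · rw [if_neg hgood]
    linarith

/-- **The formal kill criterion of the core (periodic defect price for separated periodic competitors;
the route review's O1 glue, at the primal level).** From `Sig.stub_stationaryMeansRigidity` and the tool
stubs T1–T3: with the core's `P, κ, c, Q` (so `e(Q) ≤ c + κθ`), EVERY periodic configuration `Q'` of `ℝ³`
with `δ`-separated point set satisfies `c + κ · (fraction of motif sites of Q' whose (R, ε)-pattern is not
an isometric copy of P's) ≤ e(Q')`: instantiate the core with the mean family of `Q'` (T1, T2), note that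
the defect indicator is a cylinder functional of radius `R + ε` (`levelLift_good_ballPattern_iff` +
projectivity) and let `ρ → ∞` in the truncated energies (T3). A `δ`-separated all-bad periodic family with
`e(Q'_n) → inf_Q e(Q)` therefore refutes the core (and the line). [folklore] -/
theorem periodicDefectPrice_of (hA : Sig.stub_stationaryMeansRigidity) (hT1 : Sig.stub_periodicMeanFamily)
    (hT2 : Sig.stub_periodicTransport) (hT3 : Sig.stub_periodicTruncatedEnergy) :
    ∃ P : Literature.MathematicalPhysics.StatisticalMechanics.PeriodicConfiguration 3, ∀ δ R ε θ : ℝ, 0 < δ → 0 < R → 0 < ε → 0 < θ →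
      ∃ (κ c : ℝ) (Q : Literature.MathematicalPhysics.StatisticalMechanics.PeriodicConfiguration 3), 0 < κ ∧ κ ≤ 1 ∧
        Q.energyPerParticle Literature.MathematicalPhysics.StatisticalMechanics.lennardJones ≤ c + κ * θ ∧
        ∀ Q' : Literature.MathematicalPhysics.StatisticalMechanics.PeriodicConfiguration 3, (∀ x ∈ Q'.points, ∀ y ∈ Q'.points, x ≠ y → δ ≤ dist x y) →
          c + κ * ((Q'.motif.card : ℝ)⁻¹ * ∑ x ∈ Q'.motif, (if (∃ A : EuclideanSpace ℝ (Fin 3) →ₗᵢ[ℝ] EuclideanSpace ℝ (Fin 3), (∀ p ∈ P.points, ‖p‖ ≤ R → ∃ v ∈ insert (0 : EuclideanSpace ℝ (Fin 3)) (((Literature.MathematicalPhysics.StatisticalMechanics.PeriodicConfiguration.finite_inter_points Q' (Metric.isBounded_closedBall (x := x) (r := (R + ε)))).toFinset.erase x).image (fun y => y - x)), dist v (A p) ≤ ε) ∧ (∀ v ∈ insert (0 : EuclideanSpace ℝ (Fin 3)) (((Literature.MathematicalPhysics.StatisticalMechanics.PeriodicConfiguration.finite_inter_points Q' (Metric.isBounded_closedBall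 (x := x) (r := (R + ε)))).toFinset.erase x).image (fun y => y - x)), ‖v‖ ≤ R → ∃ p ∈ P.points, dist v (A p) ≤ ε)) then (0 : ℝ) else 1)) ≤
            Q'.energyPerParticle Literature.MathematicalPhysics.StatisticalMechanics.lennardJones := by
  obtain ⟨P, hP⟩ := hA
  refine ⟨P, fun δ R ε θ hδ hR hε hθ => ?_⟩
  obtain ⟨κ, c, Q, hκ0, hκ1, hQ, hprim⟩ := hP δ R ε θ hδ hR hε hθ
  refine ⟨κ, c, Q, hκ0, hκ1, hQ, fun Q' hsep => ?_⟩
  obtain ⟨G1, G2, G3, G4, G5⟩ := hT1 δ Q' hδ hsep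
  have G6 : ∀ r ρ : ℝ, 0 ≤ r → ∀ g : EuclideanSpace ℝ (Fin 3) → Finset (EuclideanSpace ℝ (Fin 3)) → Finset (EuclideanSpace ℝ (Fin 3)) → ℝ, (∃ M : ℝ, ∀ v p q, |g v p q| ≤ M) →
      (fun (ρ : ℝ) (f : Finset (EuclideanSpace ℝ (Fin 3)) → ℝ) => (Q'.motif.card : ℝ)⁻¹ * ∑ x ∈ Q'.motif, f (((Literature.MathematicalPhysics.StatisticalMechanics.PeriodicConfiguration.finite_inter_points Q' (Metric.isBounded_closedBall (x := x) (r := ρ))).toFinset.erase x).image (fun y => y - x))) ρ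
        (fun S => ∑ v ∈ Literature.Probability.PointProcesses.lens r ρ S, (g v (Literature.Probability.PointProcesses.ballPattern r S) (Literature.Probability.PointProcesses.ballPattern r (Literature.Probability.PointProcesses.reroot S v)) - g (-v) (Literature.Probability.PointProcesses.ballPattern r (Literature.Probability.PointProcesses.reroot S v)) (Literature.Probability.PointProcesses.ballPattern r S))) = 0 := by
    intro r ρ hr g _
    have h := hT2 Q' r ρ hr g
    beta_reduce at h ⊢
    rw [h, mul_zero]
  have key := hprim (fun (ρ : ℝ) (f : Finset (EuclideanSpace ℝ (Fin 3)) → ℝ) => (Q'.motif.card : ℝ)⁻¹ * ∑ x ∈ Q'.motif, f (((Literature.MathematicalPhysics.StatisticalMechanics.PeriodicConfiguration.finite_inter_points Q' (Metric.isBounded_closedBall (x := x) (r := ρ))).toFinset.erase x).image (fun y => y - x)))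
    G1 G2 G3 G4 G5 G6
  beta_reduce at key
  -- the defect term is a cylinder functional of radius `R + ε`
  have hbad : ∀ ρ : ℝ, R + ε ≤ ρ →
      (Q'.motif.card : ℝ)⁻¹ * ∑ x ∈ Q'.motif, (if (∃ A : EuclideanSpace ℝ (Fin 3) →ₗᵢ[ℝ] EuclideanSpace ℝ (Fin 3), (∀ p ∈ P.points, ‖p‖ ≤ R → ∃ v ∈ insert (0 : EuclideanSpace ℝ (Fin 3)) (((Literature.MathematicalPhysics.StatisticalMechanics.PeriodicConfiguration.finite_inter_points Q' (Metric.isBounded_closedBall (x := x) (r := ρ))).toFinset.erase x).image (fun y => y - x)), dist v (A p) ≤ ε) ∧ (∀ v ∈ insert (0 : EuclideanSpace ℝ (Fin 3)) (((Literature.MathematicalPhysics.StatisticalMechanics.PeriodicConfiguration.finite_inter_points Q' (Metric.isBounded_closedBall (x := x) (r := ρ))).toFinset.erase x).image (fun y => y - x)), ‖v‖ ≤ R → ∃ p ∈ P.points, dist v (A p) ≤ ε)) then (0 : ℝ) else 1) = (Q'.motif.card : ℝ)⁻¹ * ∑ x ∈ Q'.motif, (if (∃ A : EuclideanSpace ℝ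 (Fin 3) →ₗᵢ[ℝ] EuclideanSpace ℝ (Fin 3), (∀ p ∈ P.points, ‖p‖ ≤ R → ∃ v ∈ insert (0 : EuclideanSpace ℝ (Fin 3)) (((Literature.MathematicalPhysics.StatisticalMechanics.PeriodicConfiguration.finite_inter_points Q' (Metric.isBounded_closedBall (x := x) (r := (R + ε)))).toFinset.erase x).image (fun y => y - x)), dist v (A p) ≤ ε) ∧ (∀ v ∈ insert (0 : EuclideanSpace ℝ (Fin 3)) (((Literature.MathematicalPhysics.StatisticalMechanics.PeriodicConfiguration.finite_inter_points Q' (Metric.isBounded_closedBall (x := x) (r := (R + ε)))).toFinset.erase x).image (fun y => y - x)), ‖v‖ ≤ R → ∃ p ∈ P.points, dist v (A p) ≤ ε)) then (0 : ℝ) else 1) := by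
    intro ρ hρ
    have h5 := G5 (R + ε) ρ hρ (fun S => (if (∃ A : EuclideanSpace ℝ (Fin 3) →ₗᵢ[ℝ] EuclideanSpace ℝ (Fin 3), (∀ p ∈ P.points, ‖p‖ ≤ R → ∃ v ∈ insert (0 : EuclideanSpace ℝ (Fin 3)) S, dist v (A p) ≤ ε) ∧ (∀ v ∈ insert (0 : EuclideanSpace ℝ (Fin 3)) S, ‖v‖ ≤ R → ∃ p ∈ P.points, dist v (A p) ≤ ε)) then (0 : ℝ) else 1))
    beta_reduce at h5
    rw [← h5]
    congr 1
    refine Finset.sum_congr rfl fun x _ => ?_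
    rw [Summit.AtomisticToContinuum.Crystallization.Theorems.PatternPricedCertificates.levelLift_good_ballPattern_iff
      P hε.le le_rfl]
  -- let `ρ → ∞` in the truncated energies
  have hlim := hT3 Q'
  refine ge_of_tendsto hlim (Filter.eventually_atTop.2 ⟨max (R + ε) 1, fun ρ hρ => ?_⟩)
  have h1 : R + ε ≤ ρ := (le_max_left _ _).trans hρ
  have h2 : 1 ≤ ρ := (le_max_right _ _).trans hρ
  have hk := key ρ h1 h2
  rw [hbad ρ h1] at hk
  exact hk

end Composition


/-! ## Reshape v9 (lead c2): the σ-ADDITIVE BRIDGE — the open core from `PalmRigidity` (stmt-9224) and hcp uniqueness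

`stub_qualitativeMeansRigidity` (finitely additive all-scales Palm rigidity) is DERIVED from
* the σ-additive Palm rigidity `PalmRigidity` — item stmt-AtomisticToContinuum-9224, the OPEN target of route
  `PalmUnimodularRigidity`, taken BY NAME as the hypothesis `hPalm` of the skeleton theorem (this crux is honestly
  blocked on it), and
* `stub_hcpUnique` — the exactly minimising hcp stackings of the box `[1/2,2]²` are one isometry class (the ∃P content),
through four PROVABLE bridge stubs over the tree's compact metric space `RootedHardCoreConfig ℝ³ δ` of rooted hard-core
configurations (local rubber metric; Literature/Probability/Process) and Mathlib's Riesz–Markov–Kakutani theorem: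
`stub_meanToLaw` (a mean family is represented on continuous functionals by a probability law `Q`, Banach limit + RMK),
`stub_meanCampbell` (the Campbell / re-rooting identity of `Q` on continuous local test functions, from the finite-level
transports of `ℓ`), `stub_campbellToStationary` (⇒ `IsPointStationaryLaw` of `Q.map (S ↦ count|S)`),
`stub_lawEnergy` (`E_Q[½h] ≤ e⋆` from minimal energy of `ℓ`), the proved push-forward lemma `lawToPalm`, and
`stub_lawBack` (a.s. exact `P`-structure ⇒ `ℓ (bad) = 0` by inner regularity, Urysohn and the open matching event).
Composition `qualitativeMeansRigidity_of_palm`, kernel-checked below.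
-/

/-- **Stub B1 (Riesz representation of a mean family on the compact configuration space).** For `δ > 0`, a
finite embedding `ι` of patterns into rooted `δ`-hard-core configurations and a mean family `ℓ` (additive, homogeneous,
positive on `[0,1]`-valued functionals on admissible patterns, normalised), there is a probability law `Q` on
`RootedHardCoreConfig ℝ³ δ` such that for every continuous `F`, `∫ F dQ` lies between the eventual lower and upper
bounds of `n ↦ ℓ n (F ∘ ι)` (a Banach limit of `n ↦ ℓ n (F ∘ ι)` is a positive normalised linear functional on
`C(𝒳) = C_c(𝒳)`; Riesz–Markov–Kakutani `RealRMK.rieszMeasure`, `integral_rieszMeasure`). [folklore] -/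
theorem stub_meanToLaw :
    ∀ δ : ℝ, 0 < δ → ∀ ι : Finset (EuclideanSpace ℝ (Fin 3)) → Literature.Probability.Process.LocalConfig.RootedHardCoreConfig (EuclideanSpace ℝ (Fin 3)) δ, ∀ ℓ : ℝ → (Finset (EuclideanSpace ℝ (Fin 3)) → ℝ) → ℝ,
      (∀ (ρ : ℝ) (f₁ f₂ : Finset (EuclideanSpace ℝ (Fin 3)) → ℝ), ℓ ρ (f₁ + f₂) = ℓ ρ f₁ + ℓ ρ f₂) →
      (∀ (ρ t : ℝ) (f : Finset (EuclideanSpace ℝ (Fin 3)) → ℝ), ℓ ρ (t • f) = t * ℓ ρ f) →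
      (∀ (ρ : ℝ) (f : Finset (EuclideanSpace ℝ (Fin 3)) → ℝ), (∀ S : Finset (EuclideanSpace ℝ (Fin 3)), Literature.Probability.PointProcesses.IsRootedPattern δ ρ S → 0 ≤ f S ∧ f S ≤ 1) → 0 ≤ ℓ ρ f) →
      (∀ ρ : ℝ, ℓ ρ (fun _ => 1) = 1) →
      ∃ Q : MeasureTheory.Measure (Literature.Probability.Process.LocalConfig.RootedHardCoreConfig (EuclideanSpace ℝ (Fin 3)) δ), MeasureTheory.IsProbabilityMeasure Q ∧
        (∀ F : Literature.Probability.Process.LocalConfig.RootedHardCoreConfig (EuclideanSpace ℝ (Fin 3)) δ → ℝ, Continuous F → ∀ c : ℝ, ((∃ n₀ : ℕ, ∀ n : ℕ, n₀ ≤ n → c ≤ ℓ (n : ℝ) (fun T => F (ι T))) → c ≤ ∫ x, F x ∂Q) ∧ ((∃ n₀ : ℕ, ∀ n : ℕ, n₀ ≤ n → ℓ (n : ℝ) (fun T => F (ι T)) ≤ c) → ∫ x, F x ∂Q ≤ c)) := by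
  exact Summit.AtomisticToContinuum.Crystallization.Theorems.PatternPricedCertificates.stub_meanToLaw

/-- **Stub B2a (the Campbell identity of the represented law).** For `Q` representing the point-stationary mean
family `ℓ` (as in `stub_meanToLaw`) and every continuous bounded `G(S, y)` vanishing for `‖y‖ > R`:
`∫ Σ_{y ∈ S} G(S, y) dQ = ∫ Σ_{y ∈ S} G(S − y, −y) dQ` (both integrands are continuous on the compact configuration
space; on a finite pattern the difference is a finite-range transport of `ℓ` up to the modulus of continuity of `G` at
the scale where configurations agreeing on a large ball are close in the local rubber metric, so `ℓ n` of it tends to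
`0`, and the representation pins the integral). [folklore] -/
theorem stub_meanCampbell :
    ∀ δ : ℝ, 0 < δ → ∀ ι : Finset (EuclideanSpace ℝ (Fin 3)) → Literature.Probability.Process.LocalConfig.RootedHardCoreConfig (EuclideanSpace ℝ (Fin 3)) δ, (∀ (ρ : ℝ) (T : Finset (EuclideanSpace ℝ (Fin 3))), Literature.Probability.PointProcesses.IsRootedPattern δ ρ T → ((↑(ι T).1 : Set (EuclideanSpace ℝ (Fin 3)))) = insert (0 : (EuclideanSpace ℝ (Fin 3))) (↑T : Set (EuclideanSpace ℝ (Fin 3)))) → ∀ ℓ : ℝ → (Finset (EuclideanSpace ℝ (Fin 3)) → ℝ) → ℝ,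
      (∀ (ρ : ℝ) (f₁ f₂ : Finset (EuclideanSpace ℝ (Fin 3)) → ℝ), ℓ ρ (f₁ + f₂) = ℓ ρ f₁ + ℓ ρ f₂) →
      (∀ (ρ t : ℝ) (f : Finset (EuclideanSpace ℝ (Fin 3)) → ℝ), ℓ ρ (t • f) = t * ℓ ρ f) →
      (∀ (ρ : ℝ) (f : Finset (EuclideanSpace ℝ (Fin 3)) → ℝ), (∀ S : Finset (EuclideanSpace ℝ (Fin 3)), Literature.Probability.PointProcesses.IsRootedPattern δ ρ S → 0 ≤ f S ∧ f S ≤ 1) → 0 ≤ ℓ ρ f) →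
      (∀ ρ : ℝ, ℓ ρ (fun _ => 1) = 1) →
      (∀ ρ ρ' : ℝ, ρ ≤ ρ' → ∀ f : Finset (EuclideanSpace ℝ (Fin 3)) → ℝ, ℓ ρ' (fun S => f (Literature.Probability.PointProcesses.ballPattern ρ S)) = ℓ ρ f) →
      (∀ r ρ : ℝ, 0 ≤ r → ∀ g : (EuclideanSpace ℝ (Fin 3)) → Finset (EuclideanSpace ℝ (Fin 3)) → Finset (EuclideanSpace ℝ (Fin 3)) → ℝ, (∃ M : ℝ, ∀ v p q, |g v p q| ≤ M) → ℓ ρ (fun S => ∑ v ∈ Literature.Probability.PointProcesses.lens r ρ S, (g v (Literature.Probability.PointProcesses.ballPattern r S) (Literature.Probability.PointProcesses.ballPattern r (Literature.Probability.PointProcesses.reroot S v)) - g (-v) (Literature.Probability.PointProcesses.ballPattern r (Literature.Probability.PointProcesses.reroot S v)) (Literature.Probability.PointProcesses.ballPattern r S))) = 0) →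
      ∀ Q : MeasureTheory.Measure (Literature.Probability.Process.LocalConfig.RootedHardCoreConfig (EuclideanSpace ℝ (Fin 3)) δ), MeasureTheory.IsProbabilityMeasure Q →
      (∀ F : Literature.Probability.Process.LocalConfig.RootedHardCoreConfig (EuclideanSpace ℝ (Fin 3)) δ → ℝ, Continuous F → ∀ c : ℝ, ((∃ n₀ : ℕ, ∀ n : ℕ, n₀ ≤ n → c ≤ ℓ (n : ℝ) (fun T => F (ι T))) → c ≤ ∫ x, F x ∂Q) ∧ ((∃ n₀ : ℕ, ∀ n : ℕ, n₀ ≤ n → ℓ (n : ℝ) (fun T => F (ι T)) ≤ c) → ∫ x, F x ∂Q ≤ c)) →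
      ∀ G : Literature.Probability.Process.LocalConfig.RootedHardCoreConfig (EuclideanSpace ℝ (Fin 3)) δ × (EuclideanSpace ℝ (Fin 3)) → ℝ, Continuous G → (∃ R : ℝ, ∀ S y, R < ‖y‖ → G (S, y) = 0) →
        (∃ M : ℝ, ∀ p, |G p| ≤ M) →
        ∫ S, (∫ y, G (S, y) ∂(Literature.Probability.Process.LocalConfig.toMeasure S.1)) ∂Q =
          ∫ S, (∫ y, (if h : y ∈ ((↑S.1 : Set (EuclideanSpace ℝ (Fin 3)))) then G (S.reroot y h, -y) else 0) ∂(Literature.Probability.Process.LocalConfig.toMeasure S.1)) ∂Q := by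
  exact Summit.AtomisticToContinuum.Crystallization.Theorems.PatternPricedCertificates.stub_meanCampbell

/-- **Stub B2b (Campbell identity ⇒ point-stationarity of the pushed-forward law).** If a probability law `Q` on
rooted `δ`-hard-core configurations satisfies the Campbell identity of `stub_meanCampbell` for all continuous bounded
`G` with bounded `y`-support, then its push-forward along `S ↦ count|S` satisfies the Mecke / mass-transport identity
`IsPointStationaryLaw` (the Campbell measure `Q ⊗ count|S` restricted to `𝒳 × B̄_R` is finite and determined by such `G`;
`isPointStationaryLaw_map_toMeasure`). [folklore] -/
theorem stub_campbellToStationary :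
    ∀ δ : ℝ, 0 < δ → ∀ Q : MeasureTheory.Measure (Literature.Probability.Process.LocalConfig.RootedHardCoreConfig (EuclideanSpace ℝ (Fin 3)) δ), MeasureTheory.IsProbabilityMeasure Q →
      (∀ G : Literature.Probability.Process.LocalConfig.RootedHardCoreConfig (EuclideanSpace ℝ (Fin 3)) δ × (EuclideanSpace ℝ (Fin 3)) → ℝ, Continuous G → (∃ R : ℝ, ∀ S y, R < ‖y‖ → G (S, y) = 0) →
        (∃ M : ℝ, ∀ p, |G p| ≤ M) →
        ∫ S, (∫ y, G (S, y) ∂(Literature.Probability.Process.LocalConfig.toMeasure S.1)) ∂Q =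
          ∫ S, (∫ y, (if h : y ∈ ((↑S.1 : Set (EuclideanSpace ℝ (Fin 3)))) then G (S.reroot y h, -y) else 0) ∂(Literature.Probability.Process.LocalConfig.toMeasure S.1)) ∂Q) →
      Literature.Probability.Process.IsPointStationaryLaw (Q.map (fun S : Literature.Probability.Process.LocalConfig.RootedHardCoreConfig (EuclideanSpace ℝ (Fin 3)) δ => Literature.Probability.Process.LocalConfig.toMeasure S.1)) := by
  exact Summit.AtomisticToContinuum.Crystallization.Theorems.PatternPricedCertificates.stub_campbellToStationary

/-- **Stub B3 (the represented law has mean root energy `≤ e⋆`).** If the mean family has minimal energy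
(`∀ η > 0 ∃ ρ ≥ 1, ℓ ρ (½h_ρ) ≤ e⋆ + η`), then `∫ (∫ V_LJ ‖y‖ d count|S)/2 dQ ≤ e⋆` for the representing law `Q`: the root
energy `S ↦ ∫ V_LJ ‖y‖ d count|S` is continuous (`continuous_integral_lennardJones_toMeasure`), on `ι T` it is the full
one-centre sum `Σ_{v ∈ T} V_LJ ‖v‖` (`V_LJ 0 = 0`), and `n ↦ ℓ n` of it is non-increasing for `n ≥ 1` (`V_LJ ≤ 0` beyond
`1`, projectivity, monotonicity of means). [folklore] -/
theorem stub_lawEnergy :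
    ∀ δ : ℝ, 0 < δ → ∀ ι : Finset (EuclideanSpace ℝ (Fin 3)) → Literature.Probability.Process.LocalConfig.RootedHardCoreConfig (EuclideanSpace ℝ (Fin 3)) δ, (∀ (ρ : ℝ) (T : Finset (EuclideanSpace ℝ (Fin 3))), Literature.Probability.PointProcesses.IsRootedPattern δ ρ T → ((↑(ι T).1 : Set (EuclideanSpace ℝ (Fin 3)))) = insert (0 : (EuclideanSpace ℝ (Fin 3))) (↑T : Set (EuclideanSpace ℝ (Fin 3)))) → ∀ ℓ : ℝ → (Finset (EuclideanSpace ℝ (Fin 3)) → ℝ) → ℝ,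
      (∀ (ρ : ℝ) (f₁ f₂ : Finset (EuclideanSpace ℝ (Fin 3)) → ℝ), ℓ ρ (f₁ + f₂) = ℓ ρ f₁ + ℓ ρ f₂) →
      (∀ (ρ t : ℝ) (f : Finset (EuclideanSpace ℝ (Fin 3)) → ℝ), ℓ ρ (t • f) = t * ℓ ρ f) →
      (∀ (ρ : ℝ) (f : Finset (EuclideanSpace ℝ (Fin 3)) → ℝ), (∀ S : Finset (EuclideanSpace ℝ (Fin 3)), Literature.Probability.PointProcesses.IsRootedPattern δ ρ S → 0 ≤ f S ∧ f S ≤ 1) → 0 ≤ ℓ ρ f) →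
      (∀ ρ : ℝ, ℓ ρ (fun _ => 1) = 1) →
      (∀ ρ ρ' : ℝ, ρ ≤ ρ' → ∀ f : Finset (EuclideanSpace ℝ (Fin 3)) → ℝ, ℓ ρ' (fun S => f (Literature.Probability.PointProcesses.ballPattern ρ S)) = ℓ ρ f) →
      (∀ η : ℝ, 0 < η → ∃ ρ : ℝ, 1 ≤ ρ ∧ ℓ ρ (fun S => (∑ v ∈ S, Literature.MathematicalPhysics.StatisticalMechanics.lennardJones ‖v‖) / 2) ≤ (⨅ Q : Literature.MathematicalPhysics.StatisticalMechanics.PeriodicConfiguration 3, Q.energyPerParticle Literature.MathematicalPhysics.StatisticalMechanics.lennardJones) + η) →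
      ∀ Q : MeasureTheory.Measure (Literature.Probability.Process.LocalConfig.RootedHardCoreConfig (EuclideanSpace ℝ (Fin 3)) δ), MeasureTheory.IsProbabilityMeasure Q →
      (∀ F : Literature.Probability.Process.LocalConfig.RootedHardCoreConfig (EuclideanSpace ℝ (Fin 3)) δ → ℝ, Continuous F → ∀ c : ℝ, ((∃ n₀ : ℕ, ∀ n : ℕ, n₀ ≤ n → c ≤ ℓ (n : ℝ) (fun T => F (ι T))) → c ≤ ∫ x, F x ∂Q) ∧ ((∃ n₀ : ℕ, ∀ n : ℕ, n₀ ≤ n → ℓ (n : ℝ) (fun T => F (ι T)) ≤ c) → ∫ x, F x ∂Q ≤ c)) →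
      (∫ S, (∫ y, Literature.MathematicalPhysics.StatisticalMechanics.lennardJones ‖y‖ ∂(Literature.Probability.Process.LocalConfig.toMeasure S.1)) / 2 ∂Q) ≤ (⨅ Q : Literature.MathematicalPhysics.StatisticalMechanics.PeriodicConfiguration 3, Q.energyPerParticle Literature.MathematicalPhysics.StatisticalMechanics.lennardJones) := by
  exact Summit.AtomisticToContinuum.Crystallization.Theorems.PatternPricedCertificates.stub_lawEnergy

/-- **Lemma B4 (push-forward to configurations-as-measures; proved).** For a probability law `Q` on rooted
`δ`-hard-core configurations, the push-forward `P = Q.map (S ↦ count|S)` along the measurable embedding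
(`measurableEmbedding_toMeasure`) is a probability law, `P`-a.e. `μ` is the counting measure of a rooted `δ`-separated
set, mean root energies agree, and `count|S = count|X` forces `S = X`. [folklore] -/
theorem lawToPalm :
    ∀ δ : ℝ, 0 < δ → ∀ Q : MeasureTheory.Measure (Literature.Probability.Process.LocalConfig.RootedHardCoreConfig (EuclideanSpace ℝ (Fin 3)) δ), MeasureTheory.IsProbabilityMeasure Q →
      MeasureTheory.IsProbabilityMeasure (Q.map (fun S : Literature.Probability.Process.LocalConfig.RootedHardCoreConfig (EuclideanSpace ℝ (Fin 3)) δ => Literature.Probability.Process.LocalConfig.toMeasure S.1)) ∧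
      (∀ᵐ μ ∂(Q.map (fun S : Literature.Probability.Process.LocalConfig.RootedHardCoreConfig (EuclideanSpace ℝ (Fin 3)) δ => Literature.Probability.Process.LocalConfig.toMeasure S.1)), (∃ S : Set (EuclideanSpace ℝ (Fin 3)), (0 : (EuclideanSpace ℝ (Fin 3))) ∈ S ∧ (∀ x ∈ S, ∀ y ∈ S, x ≠ y → δ ≤ dist x y) ∧ μ = (MeasureTheory.Measure.count : MeasureTheory.Measure (EuclideanSpace ℝ (Fin 3))).restrict S)) ∧
      (∫ μ, (∫ y, Literature.MathematicalPhysics.StatisticalMechanics.lennardJones ‖y‖ ∂μ) / 2 ∂(Q.map (fun S : Literature.Probability.Process.LocalConfig.RootedHardCoreConfig (EuclideanSpace ℝ (Fin 3)) δ => Literature.Probability.Process.LocalConfig.toMeasure S.1))) = ∫ S, (∫ y, Literature.MathematicalPhysics.StatisticalMechanics.lennardJones ‖y‖ ∂(Literature.Probability.Process.LocalConfig.toMeasure S.1)) / 2 ∂Q ∧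
      (∀ (S : Literature.Probability.Process.LocalConfig.RootedHardCoreConfig (EuclideanSpace ℝ (Fin 3)) δ) (X : Set (EuclideanSpace ℝ (Fin 3))), Literature.Probability.Process.LocalConfig.toMeasure S.1 = (MeasureTheory.Measure.count : MeasureTheory.Measure (EuclideanSpace ℝ (Fin 3))).restrict X → ((↑S.1 : Set (EuclideanSpace ℝ (Fin 3)))) = X) := by
  intro δ hδ Q hQ
  haveI : Fact (0 < δ) := ⟨hδ⟩
  have hemb := Summit.AtomisticToContinuum.Crystallization.Theorems.BenjaminiSchrammLimit.measurableEmbedding_toMeasure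
    (EuclideanSpace ℝ (Fin 3)) (δ := δ)
  refine ⟨MeasureTheory.Measure.isProbabilityMeasure_map hemb.measurable.aemeasurable, ?_, hemb.integral_map _, ?_⟩
  · rw [hemb.ae_map_iff]
    filter_upwards with S
    exact ⟨(↑S.1 : Set (EuclideanSpace ℝ (Fin 3))), S.2.1, S.2.2, rfl⟩
  · intro S X h
    ext x
    rw [← Literature.Probability.Process.count_restrict_singleton_ne_zero_iff (↑S.1 : Set (EuclideanSpace ℝ (Fin 3))) x,
      ← Literature.Probability.Process.count_restrict_singleton_ne_zero_iff X x,
      ← Literature.Probability.Process.LocalConfig.toMeasure_def, h]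

/-- **Stub B5' (box-local form: the Lennard-Jones hcp family has a UNIQUE minimiser on `[1/2,2]²`) — LANDED by name (p171947,
`Theorems/FrustrationRangeCertificatesPatternPricedCertificatesSplit.lean`).** Some `(a₀, h₀)` of the box is tied-or-beaten by no other
parameter pair of the box: `e(hcp a h) ≤ e(hcp a₀ h₀) ⇒ (a, h) = (a₀, h₀)`. Proof in the tree: the global minimiser of the total hcp energy
`hcpE` exists in `[189/200,199/200] × [77/100,163/200]` (`stub_relaxedReference`) and is unique over the open quadrant
(`tube_hcpE_unique_minimiser`, certified lattice sums `hcpSumS`; numerically `h₀/a₀ ≈ 0.816`, `a₀ ≈ 0.971`, `h₀ ≈ 0.793`), and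
`e(hcp_{a,h}) = hcpE a h` (`energyPerParticle_hcp_eq_hcpE`). [folklore] -/
theorem stub_hcpUniqueMinimiser :
    ∃ (a₀ h₀ : ℝ) (ha₀ : a₀ ≠ 0) (hh₀ : h₀ ≠ 0), 1 / 2 ≤ a₀ ∧ a₀ ≤ 2 ∧ 1 / 2 ≤ h₀ ∧ h₀ ≤ 2 ∧
      ∀ (a h : ℝ) (ha : a ≠ 0) (hh : h ≠ 0), 1 / 2 ≤ a → a ≤ 2 → 1 / 2 ≤ h → h ≤ 2 →
        (Literature.MathematicalPhysics.StatisticalMechanics.hcpPeriodicConfiguration ha hh).energyPerParticle Literature.MathematicalPhysics.StatisticalMechanics.lennardJones ≤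
          (Literature.MathematicalPhysics.StatisticalMechanics.hcpPeriodicConfiguration ha₀ hh₀).energyPerParticle Literature.MathematicalPhysics.StatisticalMechanics.lennardJones →
        a = a₀ ∧ h = h₀ := by
  exact Summit.AtomisticToContinuum.Crystallization.Theorems.PatternPricedCertificates.stub_hcpUniqueMinimiser

/-- **B5 (the exactly minimising hcp stackings of the box are one isometry class), DERIVED from B5'** (`stub_hcpUniqueMinimiser`): an hcp
stacking attaining `e⋆ ≤ e(·)` is a minimiser of the family, hence the unique one (landed as `hcpUnique_of_uniqueMinimiser`). [folklore] -/
theorem stub_hcpUnique :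
    ∃ P : Literature.MathematicalPhysics.StatisticalMechanics.PeriodicConfiguration 3, ∀ (a h : ℝ) (ha : a ≠ 0) (hh : h ≠ 0), 1 / 2 ≤ a → a ≤ 2 → 1 / 2 ≤ h → h ≤ 2 →
      (Literature.MathematicalPhysics.StatisticalMechanics.hcpPeriodicConfiguration ha hh).energyPerParticle Literature.MathematicalPhysics.StatisticalMechanics.lennardJones = (⨅ Q : Literature.MathematicalPhysics.StatisticalMechanics.PeriodicConfiguration 3, Q.energyPerParticle Literature.MathematicalPhysics.StatisticalMechanics.lennardJones) →
      ∃ L : (EuclideanSpace ℝ (Fin 3)) ≃ₗᵢ[ℝ] (EuclideanSpace ℝ (Fin 3)), (⇑L) '' P.points = Literature.MathematicalPhysics.StatisticalMechanics.hcpStacking a h := by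
  obtain ⟨a₀, h₀, ha₀, hh₀, ha₁, ha₂, hh₁, hh₂, huniq⟩ := stub_hcpUniqueMinimiser
  refine ⟨Literature.MathematicalPhysics.StatisticalMechanics.hcpPeriodicConfiguration ha₀ hh₀, fun a h ha hh h1 h2 h3 h4 heq => ?_⟩
  have hle : (Literature.MathematicalPhysics.StatisticalMechanics.hcpPeriodicConfiguration ha hh).energyPerParticle
        Literature.MathematicalPhysics.StatisticalMechanics.lennardJones ≤
      (Literature.MathematicalPhysics.StatisticalMechanics.hcpPeriodicConfiguration ha₀ hh₀).energyPerParticle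
        Literature.MathematicalPhysics.StatisticalMechanics.lennardJones := by
    rw [heq]
    exact Summit.AtomisticToContinuum.Crystallization.Theorems.ChargedEnergyGapNegative.eStar_le _
  obtain ⟨rfl, rfl⟩ := huniq a h ha hh h1 h2 h3 h4 hle
  refine ⟨LinearIsometryEquiv.refl ℝ (EuclideanSpace ℝ (Fin 3)), ?_⟩
  rw [Literature.MathematicalPhysics.StatisticalMechanics.hcpPeriodicConfiguration_points]
  simp

/-- **Stub B6 (back to the mean: almost-sure exact `P`-structure kills the defect mass).** If `Q` represents the
mean family `ℓ` and `Q`-a.s. the configuration IS a linear-isometric copy of `P.points`, then `ℓ (R+ε) (bad_{P,R,ε}) = 0`: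
the strict `(R, ε)`-matching event `U` (`isOpen_setOf_locallyMatches`, union over isometries) is open of full
`Q`-measure and implies the `(R, ε)`-good predicate; by inner regularity and Urysohn there are continuous `f ≤ 1_U` with
`∫ f dQ` close to `1`, and the representation forces `ℓ n (f ∘ ι)`, hence `ℓ (R+ε) (good)`, above `1 − η` frequently;
projectivity makes the latter independent of `n`. [folklore] -/
theorem stub_lawBack :
    ∀ δ : ℝ, 0 < δ → ∀ ι : Finset (EuclideanSpace ℝ (Fin 3)) → Literature.Probability.Process.LocalConfig.RootedHardCoreConfig (EuclideanSpace ℝ (Fin 3)) δ, (∀ (ρ : ℝ) (T : Finset (EuclideanSpace ℝ (Fin 3))), Literature.Probability.PointProcesses.IsRootedPattern δ ρ T → ((↑(ι T).1 : Set (EuclideanSpace ℝ (Fin 3)))) = insert (0 : (EuclideanSpace ℝ (Fin 3))) (↑T : Set (EuclideanSpace ℝ (Fin 3)))) → ∀ ℓ : ℝ → (Finset (EuclideanSpace ℝ (Fin 3)) → ℝ) → ℝ,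
      (∀ (ρ : ℝ) (f₁ f₂ : Finset (EuclideanSpace ℝ (Fin 3)) → ℝ), ℓ ρ (f₁ + f₂) = ℓ ρ f₁ + ℓ ρ f₂) →
      (∀ (ρ t : ℝ) (f : Finset (EuclideanSpace ℝ (Fin 3)) → ℝ), ℓ ρ (t • f) = t * ℓ ρ f) →
      (∀ (ρ : ℝ) (f : Finset (EuclideanSpace ℝ (Fin 3)) → ℝ), (∀ S : Finset (EuclideanSpace ℝ (Fin 3)), Literature.Probability.PointProcesses.IsRootedPattern δ ρ S → 0 ≤ f S ∧ f S ≤ 1) → 0 ≤ ℓ ρ f) →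
      (∀ ρ : ℝ, ℓ ρ (fun _ => 1) = 1) →
      (∀ ρ ρ' : ℝ, ρ ≤ ρ' → ∀ f : Finset (EuclideanSpace ℝ (Fin 3)) → ℝ, ℓ ρ' (fun S => f (Literature.Probability.PointProcesses.ballPattern ρ S)) = ℓ ρ f) →
      ∀ Q : MeasureTheory.Measure (Literature.Probability.Process.LocalConfig.RootedHardCoreConfig (EuclideanSpace ℝ (Fin 3)) δ), MeasureTheory.IsProbabilityMeasure Q →
      (∀ F : Literature.Probability.Process.LocalConfig.RootedHardCoreConfig (EuclideanSpace ℝ (Fin 3)) δ → ℝ, Continuous F → ∀ c : ℝ, ((∃ n₀ : ℕ, ∀ n : ℕ, n₀ ≤ n → c ≤ ℓ (n : ℝ) (fun T => F (ι T))) → c ≤ ∫ x, F x ∂Q) ∧ ((∃ n₀ : ℕ, ∀ n : ℕ, n₀ ≤ n → ℓ (n : ℝ) (fun T => F (ι T)) ≤ c) → ∫ x, F x ∂Q ≤ c)) →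
      ∀ P : Literature.MathematicalPhysics.StatisticalMechanics.PeriodicConfiguration 3, (∀ᵐ S ∂Q, ∃ L : (EuclideanSpace ℝ (Fin 3)) ≃ₗᵢ[ℝ] (EuclideanSpace ℝ (Fin 3)), ((↑S.1 : Set (EuclideanSpace ℝ (Fin 3)))) = (⇑L) '' P.points) →
        ∀ R ε : ℝ, 0 < R → 0 < ε →
          ℓ (R + ε) (fun S => (if (∃ A : (EuclideanSpace ℝ (Fin 3)) →ₗᵢ[ℝ] (EuclideanSpace ℝ (Fin 3)), (∀ p ∈ P.points, ‖p‖ ≤ R → ∃ v ∈ insert (0 : (EuclideanSpace ℝ (Fin 3))) S, dist v (A p) ≤ ε) ∧ (∀ v ∈ insert (0 : (EuclideanSpace ℝ (Fin 3))) S, ‖v‖ ≤ R → ∃ p ∈ P.points, dist v (A p) ≤ ε)) then (0 : ℝ) else 1)) = 0 := by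
  exact Summit.AtomisticToContinuum.Crystallization.Theorems.PatternPricedCertificates.stub_lawBack

/-! ## The finite embedding and the composition -/

section Composition

open Literature.Probability.PointProcesses (IsRootedPattern ballPattern lens reroot)
open Literature.MathematicalPhysics.StatisticalMechanics (lennardJones PeriodicConfiguration)
open Literature.Probability.Process

/-- **The finite embedding**: an admissible rooted pattern `T` (root at `0`, not listed) IS the rooted `δ`-hard-core
configuration `insert 0 T` (junk `{0}` on inadmissible finsets). [folklore] -/
theorem exists_finiteEmbedding {δ : ℝ} (_hδ : 0 < δ) :
    ∃ ι : Finset (EuclideanSpace ℝ (Fin 3)) → LocalConfig.RootedHardCoreConfig (EuclideanSpace ℝ (Fin 3)) δ,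
      ∀ (ρ : ℝ) (T : Finset (EuclideanSpace ℝ (Fin 3))), IsRootedPattern δ ρ T →
        ((↑(ι T).1 : Set (EuclideanSpace ℝ (Fin 3)))) = insert (0 : EuclideanSpace ℝ (Fin 3)) (↑T : Set (EuclideanSpace ℝ (Fin 3))) := by
  classical
  have hsing : (0 : EuclideanSpace ℝ (Fin 3)) ∈ (LocalConfig.mk ({0} : Set (EuclideanSpace ℝ (Fin 3)))) ∧
      ∀ x ∈ (LocalConfig.mk ({0} : Set (EuclideanSpace ℝ (Fin 3)))), ∀ y ∈ (LocalConfig.mk ({0} : Set (EuclideanSpace ℝ (Fin 3)))),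
        x ≠ y → δ ≤ dist x y := by
    refine ⟨by simp, fun x hx y hy hxy => ?_⟩
    simp only [LocalConfig.mem_mk, Set.mem_singleton_iff] at hx hy
    exact absurd (hx.trans hy.symm) hxy
  refine ⟨fun T => if h : ((0 : EuclideanSpace ℝ (Fin 3)) ∈ (LocalConfig.mk (insert (0 : EuclideanSpace ℝ (Fin 3)) (↑T : Set (EuclideanSpace ℝ (Fin 3))))) ∧
      ∀ x ∈ (LocalConfig.mk (insert (0 : EuclideanSpace ℝ (Fin 3)) (↑T : Set (EuclideanSpace ℝ (Fin 3))))),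
        ∀ y ∈ (LocalConfig.mk (insert (0 : EuclideanSpace ℝ (Fin 3)) (↑T : Set (EuclideanSpace ℝ (Fin 3))))), x ≠ y → δ ≤ dist x y)
      then ⟨_, h⟩ else ⟨_, hsing⟩, fun ρ T hT => ?_⟩
  have hadm : (0 : EuclideanSpace ℝ (Fin 3)) ∈ (LocalConfig.mk (insert (0 : EuclideanSpace ℝ (Fin 3)) (↑T : Set (EuclideanSpace ℝ (Fin 3))))) ∧
      ∀ x ∈ (LocalConfig.mk (insert (0 : EuclideanSpace ℝ (Fin 3)) (↑T : Set (EuclideanSpace ℝ (Fin 3))))),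
        ∀ y ∈ (LocalConfig.mk (insert (0 : EuclideanSpace ℝ (Fin 3)) (↑T : Set (EuclideanSpace ℝ (Fin 3))))), x ≠ y → δ ≤ dist x y := by
    refine ⟨by simp, fun x hx y hy hxy => ?_⟩
    simp only [LocalConfig.mem_mk, Set.mem_insert_iff, Finset.mem_coe] at hx hy
    rcases hx with rfl | hx
    · rcases hy with rfl | hy
      · exact absurd rfl hxy
      · rw [dist_eq_norm, zero_sub, norm_neg]; exact (hT.1 y hy).1
    · rcases hy with rfl | hy
      · rw [dist_eq_norm, sub_zero]; exact (hT.1 x hx).1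
      · rw [dist_eq_norm]; exact hT.2 x hx y hy hxy
  simp only [dif_pos hadm]
  rfl

/-- **The open core from the σ-additive Palm rigidity and hcp uniqueness** (composition of stubs B1–B6 with
`PalmRigidity`, stmt-AtomisticToContinuum-9224, taken as a hypothesis BY NAME). [folklore] -/
theorem qualitativeMeansRigidity_of_palm
    (hPalm : Summit.AtomisticToContinuum.Crystallization.Theses.PalmUnimodularRigidity.PalmRigidity) :
    ∃ P : Literature.MathematicalPhysics.StatisticalMechanics.PeriodicConfiguration 3, ∀ δ : ℝ, 0 < δ → ∀ ℓ : ℝ → (Finset (EuclideanSpace ℝ (Fin 3)) → ℝ) → ℝ,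
      (∀ (ρ : ℝ) (f₁ f₂ : Finset (EuclideanSpace ℝ (Fin 3)) → ℝ), ℓ ρ (f₁ + f₂) = ℓ ρ f₁ + ℓ ρ f₂) →
      (∀ (ρ t : ℝ) (f : Finset (EuclideanSpace ℝ (Fin 3)) → ℝ), ℓ ρ (t • f) = t * ℓ ρ f) →
      (∀ (ρ : ℝ) (f : Finset (EuclideanSpace ℝ (Fin 3)) → ℝ), (∀ S : Finset (EuclideanSpace ℝ (Fin 3)), Literature.Probability.PointProcesses.IsRootedPattern δ ρ S → 0 ≤ f S ∧ f S ≤ 1) → 0 ≤ ℓ ρ f) →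
      (∀ ρ : ℝ, ℓ ρ (fun _ => 1) = 1) →
      (∀ ρ ρ' : ℝ, ρ ≤ ρ' → ∀ f : Finset (EuclideanSpace ℝ (Fin 3)) → ℝ, ℓ ρ' (fun S => f (Literature.Probability.PointProcesses.ballPattern ρ S)) = ℓ ρ f) →
      (∀ r ρ : ℝ, 0 ≤ r → ∀ g : EuclideanSpace ℝ (Fin 3) → Finset (EuclideanSpace ℝ (Fin 3)) → Finset (EuclideanSpace ℝ (Fin 3)) → ℝ, (∃ M : ℝ, ∀ v p q, |g v p q| ≤ M) →
        ℓ ρ (fun S => ∑ v ∈ Literature.Probability.PointProcesses.lens r ρ S, (g v (Literature.Probability.PointProcesses.ballPattern r S) (Literature.Probability.PointProcesses.ballPattern r (Literature.Probability.PointProcesses.reroot S v)) - g (-v) (Literature.Probability.PointProcesses.ballPattern r (Literature.Probability.PointProcesses.reroot S v)) (Literature.Probability.PointProcesses.ballPattern r S))) = 0) →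
      (∀ η : ℝ, 0 < η → ∃ ρ : ℝ, 1 ≤ ρ ∧ ℓ ρ (fun S => (∑ v ∈ S, Literature.MathematicalPhysics.StatisticalMechanics.lennardJones ‖v‖) / 2) ≤ (⨅ Q : Literature.MathematicalPhysics.StatisticalMechanics.PeriodicConfiguration 3, Q.energyPerParticle Literature.MathematicalPhysics.StatisticalMechanics.lennardJones) + η) →
      ∀ R ε : ℝ, 0 < R → 0 < ε →
        ℓ (R + ε) (fun S => (if (∃ A : EuclideanSpace ℝ (Fin 3) →ₗᵢ[ℝ] EuclideanSpace ℝ (Fin 3), (∀ p ∈ P.points, ‖p‖ ≤ R → ∃ v ∈ insert (0 : EuclideanSpace ℝ (Fin 3)) S, dist v (A p) ≤ ε) ∧ (∀ v ∈ insert (0 : EuclideanSpace ℝ (Fin 3)) S, ‖v‖ ≤ R → ∃ p ∈ P.points, dist v (A p) ≤ ε)) then (0 : ℝ) else 1)) = 0 := by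
  obtain ⟨P, hP⟩ := stub_hcpUnique
  refine ⟨P, fun δ hδ ℓ H1 H2 H3 H4 H5 H6 H7 R ε hR hε => ?_⟩
  obtain ⟨ι, hι⟩ := exists_finiteEmbedding hδ
  obtain ⟨Q, hQ, hrepr⟩ := stub_meanToLaw δ hδ ι ℓ H1 H2 H3 H4
  have hstat := stub_campbellToStationary δ hδ Q hQ
    (stub_meanCampbell δ hδ ι hι ℓ H1 H2 H3 H4 H5 H6 Q hQ hrepr)
  have hener := stub_lawEnergy δ hδ ι hι ℓ H1 H2 H3 H4 H5 H7 Q hQ hrepr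
  obtain ⟨hprob', hcore', hener', hinj⟩ := lawToPalm δ hδ Q hQ
  have hconc := hPalm δ hδ _ hprob' hcore' hstat (by rw [hener']; exact hener)
  have hae : ∀ᵐ S ∂Q, ∃ L : EuclideanSpace ℝ (Fin 3) ≃ₗᵢ[ℝ] EuclideanSpace ℝ (Fin 3),
      ((↑S.1 : Set (EuclideanSpace ℝ (Fin 3)))) = (⇑L) '' P.points := by
    have hmeas : AEMeasurable (fun S : LocalConfig.RootedHardCoreConfig (EuclideanSpace ℝ (Fin 3)) δ =>
        LocalConfig.toMeasure S.1) Q := (LocalConfig.measurable_toMeasure hδ).aemeasurable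
    filter_upwards [MeasureTheory.ae_of_ae_map hmeas hconc] with S hS
    obtain ⟨a, h, ha, hh, ha1, ha2, hh1, hh2, A, heq, hμ⟩ := hS
    have hset := hinj S _ hμ
    obtain ⟨L, hL⟩ := hP a h ha hh ha1 ha2 hh1 hh2 heq
    refine ⟨L.trans A, ?_⟩
    rw [hset, ← hL, ← Set.image_comp]
    rfl
  exact stub_lawBack δ hδ ι hι ℓ H1 H2 H3 H4 H5 Q hQ hrepr P hae R ε hR hε

end Composition

/-! ## The skeleton theorem: the crux BY NAME (v9/v13: from the landed bridge stubs and the external stub `stub_palmRigidity`) -/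

/-- **Stub EXT (EXTERNAL — not to be attacked in this line): `PalmRigidity`, item stmt-AtomisticToContinuum-9224, the open
TARGET of route `PalmUnimodularRigidity`** (every minimising point-stationary hard-core probability law on rooted
configurations of `ℝ³` is a.s. an exactly minimising rotated hcp stacking). Declared here as a stub only so that the
skeleton names its single external obligation; with the bridge stubs B1–B6 and B5' all landed (v13) this crux IS
`blocked-on: stmt-AtomisticToContinuum-9224` (equivalently, through the closed glue items stmt-9227/9228 of that route, on its two
open cruxes `MinimiserShells` stmt-9225 and `LayeredLawsSelectHcp` stmt-9226 — `PatternPricedCertificates_of_subs`). [conjecture] -/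
theorem stub_palmRigidity : Summit.AtomisticToContinuum.Crystallization.Theses.PalmUnimodularRigidity.PalmRigidity := by
  sorry

/-- **Skeleton / assembly (v9).** The crux BY NAME: the σ-additive bridge (`qualitativeMeansRigidity_of_palm` over stubs
B1, B2a, B2b, B3, B5, B6 and the external stub `stub_palmRigidity` = stmt-9224) gives the qualitative core; compactness with
the landed unpriced bound (`stationaryMeansRigidity_of`) the priced core; level lift + duality (`dualCertificates_of`) the
dual certificate; the birth assembly (`PatternPricedCertificates_of_dual`) the crux. [folklore] -/
theorem PatternPricedCertificates_of :
    Summit.AtomisticToContinuum.Crystallization.Theses.FrustrationRangeCertificates.PatternPricedCertificates :=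
  PatternPricedCertificates_of_dual
    (dualCertificates_of (stationaryMeansRigidity_of (qualitativeMeansRigidity_of_palm stub_palmRigidity)
      unpricedMeanBound_holds) stub_levelLift stub_meanDuality)

/-- **The closed skeleton instance**: the crux by name; the only place `sorry` enters (v13) is the external stub
`stub_palmRigidity` = stmt-AtomisticToContinuum-9224. The sorry-free tree form of this theorem is
`Summit.AtomisticToContinuum.Crystallization.Theorems.PatternPricedCertificates.patternPricedCertificates_of_palmRigidity_alone`. [conjecture] -/
theorem PatternPricedCertificates_skeleton :
    Summit.AtomisticToContinuum.Crystallization.Theses.FrustrationRangeCertificates.PatternPricedCertificates :=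
  PatternPricedCertificates_of

end Summit.AtomisticToContinuum.Crystallization.Cruxes.PatternPricedCertificates.Birth

end
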